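import Literature.ComputerArithmetic.JeannerodRump2018.Theorem32
import Literature.ComputerArithmetic.Higham2002.Gamma
import Literature.ComputerArithmetic.RumpOgitaOishi2009.KFoldFaithful
import Mathlib.Tactic.Linarith
import Mathlib.Tactic.FieldSimp
import Mathlib.Tactic.Positivity
import Mathlib.Tactic.Ring
import Mathlib.Tactic.GCongr
import Mathlib.Tactic.IntervalCases

/-!
# Graillat–Lefèvre–Muller: the relative error of `xⁿ` by iterated multiplications is at most `(n-1)·u`

S. Graillat, V. Lefèvre, J.-M. Muller, *On the maximum relative error when computing integer powers
by iterated multiplications in floating-point arithmetic*, Numer. Algorithms 70 (2015), no. 3,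
653–667, doi 10.1007/s11075-015-9967-8 [GraillatLefevreMuller2015].  SOURCE READ AT THE PAGE: the
arXiv version arXiv:1402.2991 (2014, "On the maximum relative error when computing `x^n` in
floating-point arithmetic"), held as `paper:arxiv-1402.2991` (chunks p0003–p0010); the numbers
"Theorem 1/2, Property 1, Algorithm 1, Remark 1/2/3, Lemma 1/2/3, §1.1–§3.3, §5" below are those of
that text.  Typed for the engines group (HONEST FRAMING: shared numerical engines serving client
cells; rigour lives in the verifiers; every published number belongs to a client cell's ledger, not
to the engines group) — kernels lane: products and integer powers evaluated by repeated rounded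
multiplications are the elementary blocks of generated straight-line kernels, and this is the
reference a-priori bound for them.  As printed (arXiv text):

> **Theorem 1.** Assume `p ≥ 2`. If no underflow or overflow occurs then
> `(1-u)^{n-1}·πₙ ≤ π̂ₙ ≤ (1+u)^{n-1}·πₙ`.
> **Property 1.** If `k ≤ 3` then `(1 + u/(1+u))^k < 1 + k·u`.
> **Algorithm 1** (naive-power(x, n)).  `y ← x`; for `k = 2` to `n` do `y ← RN(x·y)`; return `y`.
> **Theorem 2.** Assume `p ≥ 5` (which holds in all practical cases). If `n ≤ √(2^{1/3}-1)·2^{p/2}`,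
> then `|x̂ₙ - xⁿ|/xⁿ ≤ (n-1)·u`.
> **Lemma 1.** Let `t` be a real number. If `2^e ≤ w·2^e ≤ |t| < 2^{e+1}` […] then
> `|RN(t) - t|/|t| ≤ u/w`.
> **Lemma 2.** If `0 ≤ u ≤ 2/(3n²)` then `(1+u)^{n-2}·(1 + u/(1+n²u)) ≤ 1 + (n-1)·u`.
> **Remark 2.** Assume `n ≤ √(2/3)·2^{p/2}`. If there exists `k ≤ n` such that
> `RN(x·x̂ₖ₋₁) ≤ x·x̂ₖ₋₁` then `x̂ₙ ≤ (1+(n-1)·u)·xⁿ`.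
> **Remark 3.** Assume `n ≤ √(2/3)·2^{p/2}`. If there exists `k`, `1 ≤ k ≤ n-1`, such that
> `1 + n²·u ≤ sig(x·x̂ₖ)` then `x̂ₙ ≤ (1 + (n-1)·u)·xⁿ`.
> **Lemma 3.** If `1 ≤ x < 1 + 2^{⌈p/2⌉}·u`, i.e. `x = 1 + k·2^{-p+1}` with `k < 2^{p/2-1}`, then
> `x̂₂ = 1 + 2k·2^{-p+1} = 1 + 4ku < x²`, and therefore `x̂ₙ ≤ (1+u)^{n-2}xⁿ ≤ (1+(n-1)·u)xⁿ`.
> […] if `p ≥ 5` and `n ≤ β·2^{p/2}`, then for all `x`,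
> `(1 - (n-1)·u)·xⁿ ≤ x̂ₙ ≤ (1 + (n-1)·u)·xⁿ`.  […] `p = 24: n_max = 2088`, `p = 53: 48385542`,
> `p = 113: 51953580258461959`.

READING / MODEL.  Exactly the paper's setting — radix 2, precision `p`, UNBOUNDED exponent range
("we assume that no underflow or overflow occurs"), round to nearest — in the tree's rational model
`JeannerodRump2018.IsFloatU p` (`F = {M·2^e : |M| < 2^p}` in `ℚ`), `IsRoundNearestU p fl`
(`fl` = ANY round-to-nearest map; no tie rule is fixed), `u = unitRoundoff p = 2^{-p}` (`u > 0`, `u ≤ 1/2` reused from `RumpOgitaOishi2008.u_pos`,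
`RumpOgitaOishi2009.u_le_half`).  All
statements about a given run (`1 ≤ x < 2`, Theorem 1, Lemmas 1–3, Remarks 1–3, `theorem2_unit`)
are proved for every nearest map, which is slightly more than the printed RN ∈ {ties-to-even,
ties-to-away}; the reduction of Theorem 2 from all `x ∈ F` to `1 ≤ x < 2` uses that RN commutes
with `t ↦ -t` and `t ↦ 2t`, true for both printed tie rules but not for an arbitrary nearest map,
so the all-`x` statement `theorem2` carries these two equivariances as hypotheses.  The irrational
thresholds are typed rationally: `n ≤ √(2^{1/3}-1)·2^{p/2}` as `(1 + n²u)³ ≤ 2` (equivalent; the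
`n_max` table is re-checked in this form, `nmax_table`), `n ≤ √(2/3)·2^{p/2}` as `n²u ≤ 2/3`,
`k < 2^{p/2-1}` as `(x-1)² < u`.  Indices: `naivePower fl x k = x̂ₖ`; in Remarks 2–3 and the proof
`n = i+2`, step `k = j+2`.  DEVIATIONS (stated, not hidden): Lemma 2 is proved through the exp-free
bound `(1+u)^m ≤ 1 + mu + m²u²/2` (`m²u ≤ 1`) instead of the paper's 13-term polynomial; "let `k`
be the smallest index such that …" is replaced by a discrete crossing lemma; the case `x² = 2`
needs no irrationality argument (it falls under `x² ≥ 2`); Theorem 1 is typed for an arbitrary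
multiplication tree (`MulTree`), which the paper states in words (§1.3: "the bound applies to all
recursive powering schemes", incl. LLVM's `powi`).

PROVED (3 definitions `MulTree`(+`exact/eval/mults/size/comb`), `naivePower`; 0 named facts;
0 sorry): eq. (2)–(4) `abs_fl_sub_le_zpow_mul`, `abs_fl_sub_le_mul_abs`, `exists_factor_fl`,
`fl_eq_zpow_of_lt`, the `u/(1+u)` refinement `abs_fl_sub_le_sharp`; **`theorem1_tree`** /
**`theorem1`** (eq. (6)) / `theorem1_relErr` (`ψ_{n-1}`) / `theorem1_gamma` (`γ_{n-1}`,
Higham2002.gamma); **`remark1`**; **`property1`** (+ `relErr_le_of_mults_le_three`: `n ≤ 4`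
factors ⇒ relative error `≤ (n-1)u`); **`lemma1`**; **`lemma2`** (`lemma2'` verbatim hypothesis);
**`remark2`**, **`remark3`**; **`lemma3`**; **`theorem2_unit`** (`1 ≤ x < 2`, any nearest map);
**`theorem2`** (all `x ∈ F`, RN odd and 2-scale-equivariant); **`nmax_table`** (binary32/64/128).
NOT typed: §4 (tightness examples, which need a concrete ties-to-even map and exhaustive tests),
§5 Conjecture 1 on iterated products of `n` different numbers (a conjecture, not a result), the
figures.
-/

namespace Literature.ComputerArithmetic.GraillatLefevreMuller2015

open Literature.ComputerArithmetic.JeannerodRump2018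
open Literature.ComputerArithmetic.RumpOgitaOishi2008 (u_pos)
open Literature.ComputerArithmetic.RumpOgitaOishi2009 (u_le_half)

variable {p : ℕ} {fl : ℚ → ℚ}

/-! ### §1.1–1.2: the floating-point setting (radix 2, precision `p`, unbounded exponent range,
round-to-nearest) and the relative error of one rounding -/

/-- `u = 2^{-p} ≤ 1/32` once `p ≥ 5` ("which holds in all practical cases").
[cite: GraillatLefevreMuller2015, Thm 2] -/
theorem unitRoundoff_le_of_five_le (hp : 5 ≤ p) : unitRoundoff p ≤ 1 / 32 := by
  unfold unitRoundoff
  have : (2 : ℚ) ^ 5 ≤ 2 ^ p := pow_le_pow_right₀ (by norm_num) hp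
  rw [div_le_div_iff₀ (by positivity) (by norm_num)]
  linarith

/-- `RN(t) ∈ F`. [cite: GraillatLefevreMuller2015, §1.1] -/
theorem isFloatU_fl (hfl : IsRoundNearestU p fl) (t : ℚ) : IsFloatU p (fl t) := (hfl t).1

/-- `RN` fixes the floating-point numbers. [cite: GraillatLefevreMuller2015, §1.1] -/
theorem fl_eq_self (hfl : IsRoundNearestU p fl) {g : ℚ} (hg : IsFloatU p g) : fl g = g := by
  have h := (hfl g).2 g hg
  simp only [sub_self, abs_zero] at h
  have : |g - fl g| = 0 := le_antisymm h (abs_nonneg _)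
  rw [abs_eq_zero, sub_eq_zero] at this
  exact this.symm

/-- Round-to-nearest is monotone with respect to `F` from below: a float `g ≤ t` is `≤ RN(t)`.
[cite: GraillatLefevreMuller2015, §1.1] -/
theorem le_fl_of_isFloatU_le (hfl : IsRoundNearestU p fl) {g t : ℚ} (hg : IsFloatU p g)
    (hgt : g ≤ t) : g ≤ fl t := by
  by_contra h
  push Not at h
  have h1 := (hfl t).2 g hg
  rw [abs_of_nonneg (by linarith : 0 ≤ t - fl t), abs_of_nonneg (by linarith : 0 ≤ t - g)] at h1
  linarith

/-- Round-to-nearest is monotone with respect to `F` from above: a float `g ≥ t` is `≥ RN(t)`.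
[cite: GraillatLefevreMuller2015, §1.1] -/
theorem fl_le_of_le_isFloatU (hfl : IsRoundNearestU p fl) {g t : ℚ} (hg : IsFloatU p g)
    (htg : t ≤ g) : fl t ≤ g := by
  by_contra h
  push Not at h
  have h1 := (hfl t).2 g hg
  rw [abs_of_nonpos (by linarith : t - fl t ≤ 0), abs_of_nonpos (by linarith : t - g ≤ 0)] at h1
  linarith

/-- The binade of a positive real: `2^e ≤ t < 2^{e+1}` forces `e = ⌊log₂ t⌋`.
[cite: GraillatLefevreMuller2015, §1.2] -/
theorem log_eq_of_mem_binade {t : ℚ} {e : ℤ} (ht : 0 < t) (h1 : (2 : ℚ) ^ e ≤ t)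
    (h2 : t < (2 : ℚ) ^ (e + 1)) : Int.log 2 t = e := by
  have he : e ≤ Int.log 2 t :=
    (Int.zpow_le_iff_le_log (b := 2) one_lt_two ht).mp (by exact_mod_cast h1)
  have he' : Int.log 2 t < e + 1 :=
    (Int.lt_zpow_iff_log_lt (b := 2) one_lt_two ht).mp (by exact_mod_cast h2)
  omega

/-- Eq. (1.2), first display: if `2^e ≤ t < 2^{e+1}` then `|RN(t) - t| ≤ 2^{e-p} = 2^e · u` — the
rounding is within half the spacing `2^{e+1-p}` of the binade, whatever the tie rule.
[cite: GraillatLefevreMuller2015, §1.2 eq. (2)] -/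
theorem abs_fl_sub_le_zpow_mul (hp : 1 ≤ p) (hfl : IsRoundNearestU p fl) {t : ℚ} {e : ℤ}
    (h1 : (2 : ℚ) ^ e ≤ t) (h2 : t < (2 : ℚ) ^ (e + 1)) :
    |fl t - t| ≤ (2 : ℚ) ^ e * unitRoundoff p := by
  have ht : 0 < t := lt_of_lt_of_le (zpow_pos (by norm_num) e) h1
  have hlog : Int.log 2 t = e := log_eq_of_mem_binade ht h1 h2
  obtain ⟨hcpos, hf1le, hf2gt, -, hf1, hf2, hu, -⟩ := grid_facts (p := p) hp ht
  rw [hlog] at hcpos hf1le hf2gt hf1 hf2 hu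
  set c := (2 : ℚ) ^ (e + 1 - p) with hc
  set m := ⌊t / c⌋ with hm
  have e1 := (hfl t).2 _ hf1
  have e2 := (hfl t).2 _ hf2
  rw [abs_of_nonneg (by linarith : 0 ≤ t - (m : ℚ) * c)] at e1
  rw [abs_of_nonpos (by linarith : t - ((m : ℚ) + 1) * c ≤ 0)] at e2
  have : 2 * |t - fl t| ≤ c := by linarith
  rw [abs_sub_comm]
  linarith

/-- A round-to-nearest map conjugated by negation, `t ↦ -RN(-t)`, is again a round-to-nearest map
(`F` is symmetric); this transports bounds proved for `t > 0` to `t < 0` without assuming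
`RN(-t) = -RN(t)`. [cite: GraillatLefevreMuller2015, §1.1] -/
theorem isRoundNearestU_conj_neg (hfl : IsRoundNearestU p fl) :
    IsRoundNearestU p (fun t => -fl (-t)) := by
  intro t
  refine ⟨(hfl (-t)).1.neg, fun f hf => ?_⟩
  have h := (hfl (-t)).2 (-f) hf.neg
  rw [show |t - -fl (-t)| = |-t - fl (-t)| by rw [← abs_neg]; ring_nf,
    show |t - f| = |-t - -f| by rw [← abs_neg]; ring_nf]
  exact h

/-- Eq. (1.2), second display / eq. (3): the relative error of one rounding, `|RN(t) - t| ≤ u·|t|`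
for every real `t` (unbounded exponent range). [cite: GraillatLefevreMuller2015, §1.2 eq. (3)] -/
theorem abs_fl_sub_le_mul_abs (hp : 1 ≤ p) (hfl : IsRoundNearestU p fl) (t : ℚ) :
    |fl t - t| ≤ unitRoundoff p * |t| := by
  -- the positive case, for an arbitrary nearest map
  have pos : ∀ (g : ℚ → ℚ), IsRoundNearestU p g → ∀ s : ℚ, 0 < s →
      |g s - s| ≤ unitRoundoff p * s := by
    intro g hg s hs
    have h1 : ((2 : ℕ) : ℚ) ^ Int.log 2 s ≤ s := Int.zpow_log_le_self one_lt_two hs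
    have h2 : s < ((2 : ℕ) : ℚ) ^ (Int.log 2 s + 1) := Int.lt_zpow_succ_log_self one_lt_two s
    push_cast at h1 h2
    have hu0 : 0 ≤ unitRoundoff p := (u_pos (p := p)).le
    calc |g s - s| ≤ (2 : ℚ) ^ Int.log 2 s * unitRoundoff p := abs_fl_sub_le_zpow_mul hp hg h1 h2
      _ ≤ s * unitRoundoff p := by gcongr
      _ = unitRoundoff p * s := by ring
  rcases lt_trichotomy t 0 with ht | rfl | ht
  · have h := pos _ (isRoundNearestU_conj_neg hfl) (-t) (by linarith)
    simp only [neg_neg] at h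
    rw [abs_of_neg ht, show |fl t - t| = |-fl t - -t| by rw [← abs_neg]; ring_nf]
    exact h
  · have h0 : fl 0 = 0 := fl_eq_self hfl (isFloatU_int (p := p) (M := 0) (by simp))
    simp [h0]
  · rw [abs_of_pos ht]; exact pos fl hfl t ht

/-- Eq. (4): one floating-point operation is accurate to a factor in `[1-u, 1+u]`:
`RN(z) = φ·z` with `1 - u ≤ φ ≤ 1 + u` (for `z = 0`, `φ = 1`).
[cite: GraillatLefevreMuller2015, §1.2 eq. (4)] -/
theorem exists_factor_fl (hp : 1 ≤ p) (hfl : IsRoundNearestU p fl) (z : ℚ) :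
    ∃ φ : ℚ, fl z = φ * z ∧ 1 - unitRoundoff p ≤ φ ∧ φ ≤ 1 + unitRoundoff p := by
  have hb := abs_fl_sub_le_mul_abs hp hfl z
  have hu := u_pos (p := p)
  rcases lt_trichotomy z 0 with hz | rfl | hz
  · rw [abs_of_neg hz] at hb
    obtain ⟨hb1, hb2⟩ := abs_le.mp hb
    refine ⟨fl z / z, (div_mul_cancel₀ (fl z) hz.ne).symm, ?_, ?_⟩
    · rw [le_div_iff_of_neg hz]; linarith
    · rw [div_le_iff_of_neg hz]; linarith
  · have h0 : fl 0 = 0 := fl_eq_self hfl (isFloatU_int (p := p) (M := 0) (by simp))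
    exact ⟨1, by simp [h0], by linarith, by linarith⟩
  · rw [abs_of_pos hz] at hb
    obtain ⟨hb1, hb2⟩ := abs_le.mp hb
    refine ⟨fl z / z, (div_mul_cancel₀ (fl z) hz.ne').symm, ?_, ?_⟩
    · rw [le_div_iff₀ hz]; linarith
    · rw [div_le_iff₀ hz]; linarith

/-- `RN` preserves positivity (`RN(z) ≥ (1-u)·z > 0`). [cite: GraillatLefevreMuller2015, §1.2 eq. (4)] -/
theorem fl_pos (hp : 1 ≤ p) (hfl : IsRoundNearestU p fl) {z : ℚ} (hz : 0 < z) : 0 < fl z := by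
  obtain ⟨φ, h, h1, -⟩ := exists_factor_fl hp hfl z
  have := u_le_half hp
  rw [h]; nlinarith

/-- **LEMMA 1** (the "wobbling" relative error): if `2^e ≤ w·2^e ≤ |t| < 2^{e+1}` — the significand
of `t` is at least `w` — then `|RN(t) - t| / |t| ≤ u / w`. Stated for `t > 0`.
[cite: GraillatLefevreMuller2015, Lemma 1] -/
theorem lemma1 (hp : 1 ≤ p) (hfl : IsRoundNearestU p fl) {t w : ℚ} {e : ℤ} (hw : 1 ≤ w)
    (h1 : w * (2 : ℚ) ^ e ≤ t) (h2 : t < (2 : ℚ) ^ (e + 1)) :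
    |fl t - t| ≤ unitRoundoff p / w * t := by
  have h2e : (0 : ℚ) < (2 : ℚ) ^ e := zpow_pos (by norm_num) e
  have h1' : (2 : ℚ) ^ e ≤ t := le_trans (by nlinarith) h1
  have hb := abs_fl_sub_le_zpow_mul hp hfl h1' h2
  have hw0 : 0 < w := by linarith
  calc |fl t - t| ≤ (2 : ℚ) ^ e * unitRoundoff p := hb
    _ = unitRoundoff p / w * (w * (2 : ℚ) ^ e) := by field_simp
    _ ≤ unitRoundoff p / w * t := by
        have : 0 ≤ unitRoundoff p / w := div_nonneg (u_pos (p := p)).le hw0.le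
        exact mul_le_mul_of_nonneg_left h1 this

/-- Just above a power of two the rounding is exact*ly* the power of two: if
`2^e ≤ t < (1+u)·2^e` (below the midpoint of `2^e` and its successor `2^e(1+2u)`), then
`RN(t) = 2^e`, for any tie rule. [cite: GraillatLefevreMuller2015, §1.2 and §3.2] -/
theorem fl_eq_zpow_of_lt (hp : 1 ≤ p) (hfl : IsRoundNearestU p fl) {t : ℚ} {e : ℤ}
    (h1 : (2 : ℚ) ^ e ≤ t) (h2 : t < (1 + unitRoundoff p) * (2 : ℚ) ^ e) : fl t = (2 : ℚ) ^ e := by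
  have hu := u_pos (p := p)
  have h2e : (0 : ℚ) < (2 : ℚ) ^ e := zpow_pos (by norm_num) e
  have ht : 0 < t := lt_of_lt_of_le h2e h1
  have hlt : t < (2 : ℚ) ^ (e + 1) := by
    rw [zpow_add_one₀ (by norm_num)]
    have := u_le_half hp
    nlinarith
  have hlog : Int.log 2 t = e := log_eq_of_mem_binade ht h1 hlt
  obtain ⟨hcpos, hf1le, hf2gt, hkf1, hf1, hf2, huc, hgrid⟩ := grid_facts (p := p) hp ht
  rw [hlog] at hcpos hf1le hf2gt hkf1 hf1 hf2 huc hgrid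
  set c := (2 : ℚ) ^ (e + 1 - p) with hc
  set m := ⌊t / c⌋ with hm
  have hc2 : (2 : ℚ) ^ e * unitRoundoff p * 2 = c := by rw [← huc]; ring
  -- the lower grid neighbour `m c` is `2^e` itself: a larger multiple of `c` is `≥ 2^e + c > t`
  have hmc : (m : ℚ) * c = (2 : ℚ) ^ e := by
    rcases lt_or_eq_of_le hkf1 with hgt | heq
    · exfalso
      have hp1 : (((p - 1 : ℕ) : ℤ)) = (p : ℤ) - 1 := by omega
      have h2k' : (2 : ℚ) ^ e = ((2 ^ (p - 1) : ℕ) : ℚ) * c := by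
        rw [hc]; push_cast
        rw [← zpow_natCast, ← zpow_add₀ (by norm_num : (2 : ℚ) ≠ 0), hp1]
        congr 1; ring
      have hlt' : ((2 ^ (p - 1) : ℕ) : ℚ) < (m : ℚ) := by
        have : ((2 ^ (p - 1) : ℕ) : ℚ) * c < (m : ℚ) * c := by rw [← h2k']; exact hgt
        exact lt_of_mul_lt_mul_right this hcpos.le
      have hle : ((2 ^ (p - 1) : ℕ) : ℤ) + 1 ≤ m := by
        have : ((2 ^ (p - 1) : ℕ) : ℤ) < m := by exact_mod_cast hlt'
        omega
      have hle' : (((2 ^ (p - 1) : ℕ) : ℚ) + 1) * c ≤ (m : ℚ) * c := by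
        have h' : ((((2 ^ (p - 1) : ℕ) : ℤ) + 1 : ℤ) : ℚ) ≤ (m : ℚ) := by exact_mod_cast hle
        push_cast at h' ⊢
        exact mul_le_mul_of_nonneg_right h' hcpos.le
      rw [add_mul, ← h2k', one_mul] at hle'
      nlinarith
    · exact heq.symm
  -- `RN(t) ≤ m c`: the upper neighbour `(m+1) c` is farther from `t` than `m c`
  have hfl_le : fl t ≤ (m : ℚ) * c := by
    rcases hgrid (fl t) (hfl t).1 with h | h
    · exact h
    · exfalso
      have e1 := (hfl t).2 _ hf1
      rw [abs_of_nonpos (by linarith : t - fl t ≤ 0),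
        abs_of_nonneg (by linarith : 0 ≤ t - (m : ℚ) * c)] at e1
      nlinarith
  rw [hmc] at hfl_le
  exact le_antisymm hfl_le (le_fl_of_isFloatU_le hfl (isFloatU_zpow hp e) h1)

/-- The refined relative error of one rounding (the remark attributed to Jeannerod–Rump in §1.2):
`|RN(t) - t| ≤ u/(1+u) · |t|` — if the significand of `t` is `≥ 1+u` this is Lemma 1 with
`w = 1+u`, and otherwise `RN(t) = 2^e` exactly. Positive case.
[cite: GraillatLefevreMuller2015, §1.2 (before Property 1)] -/
theorem abs_fl_sub_le_sharp_pos (hp : 1 ≤ p) (hfl : IsRoundNearestU p fl) {t : ℚ} (ht : 0 < t) :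
    |fl t - t| ≤ unitRoundoff p / (1 + unitRoundoff p) * t := by
  have hu := u_pos (p := p)
  have h2k : (0 : ℚ) < (2 : ℚ) ^ Int.log 2 t := zpow_pos (by norm_num) _
  have hge : (2 : ℚ) ^ Int.log 2 t ≤ t := by
    have := Int.zpow_log_le_self (b := 2) one_lt_two ht
    push_cast at this; exact this
  have hlt : t < (2 : ℚ) ^ (Int.log 2 t + 1) := by
    have := Int.lt_zpow_succ_log_self (b := 2) one_lt_two t
    push_cast at this; exact this
  by_cases hcase : (1 + unitRoundoff p) * (2 : ℚ) ^ Int.log 2 t ≤ t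
  · -- significand ≥ 1 + u: Lemma 1
    exact lemma1 hp hfl (by linarith) hcase hlt
  · push Not at hcase
    -- RN(t) = 2^k and t - 2^k ≤ u/(1+u) · t  ⟺  t ≤ (1+u) 2^k
    have hfl_eq := fl_eq_zpow_of_lt hp hfl hge hcase
    rw [hfl_eq, abs_sub_comm, abs_of_nonneg (by linarith)]
    have key : (t - (2 : ℚ) ^ Int.log 2 t) * (1 + unitRoundoff p) ≤ unitRoundoff p * t := by
      nlinarith
    have h1u : (0 : ℚ) < 1 + unitRoundoff p := by linarith
    calc t - (2 : ℚ) ^ Int.log 2 t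
        = (t - (2 : ℚ) ^ Int.log 2 t) * (1 + unitRoundoff p) / (1 + unitRoundoff p) := by
          field_simp
      _ ≤ unitRoundoff p * t / (1 + unitRoundoff p) := by gcongr
      _ = unitRoundoff p / (1 + unitRoundoff p) * t := by ring

/-- The refined bound for every real `t`: `|RN(t) - t| ≤ u/(1+u) · |t|` ("the maximum relative error
due to rounding is bounded by `u/(1+u)`"). [cite: GraillatLefevreMuller2015, §1.2 (before Property 1)] -/
theorem abs_fl_sub_le_sharp (hp : 1 ≤ p) (hfl : IsRoundNearestU p fl) (t : ℚ) :
    |fl t - t| ≤ unitRoundoff p / (1 + unitRoundoff p) * |t| := by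
  rcases lt_trichotomy t 0 with ht | rfl | ht
  · have h := abs_fl_sub_le_sharp_pos hp (isRoundNearestU_conj_neg hfl) (t := -t) (by linarith)
    simp only [neg_neg] at h
    rw [abs_of_neg ht, show |fl t - t| = |-fl t - -t| by rw [← abs_neg]; ring_nf]
    exact h
  · have h0 : fl 0 = 0 := fl_eq_self hfl (isFloatU_int (p := p) (M := 0) (by simp))
    simp [h0]
  · rw [abs_of_pos ht]; exact abs_fl_sub_le_sharp_pos hp hfl ht

/-! ### §1.3: products of `n` floating-point numbers by `n-1` rounded multiplications (Theorem 1)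

The paper states Theorem 1 for the left-to-right product `RN(⋯RN(RN(a₁a₂)a₃)⋯aₙ)` (eq. (5)) and
notes (§1.3, after Algorithm 1) that the same bound covers *any* recursive scheme in which
`x^{k+ℓ}` is deduced from `x^k`, `x^ℓ` by one rounded multiplication (binary powering, LLVM's
`powi`, …).  We therefore type the result for an arbitrary binary multiplication tree and
specialise. -/

/-- A parenthesisation of a product: leaves are the factors, each internal node is one
floating-point multiplication. [cite: GraillatLefevreMuller2015, §1.3] -/
inductive MulTree : Type
  | leaf : ℚ → MulTree
  | node : MulTree → MulTree → MulTree

namespace MulTree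

/-- The exact product `π`. [cite: GraillatLefevreMuller2015, §1.3] -/
def exact : MulTree → ℚ
  | leaf a => a
  | node l r => exact l * exact r

/-- The computed product `π̂`: every internal node is rounded. [cite: GraillatLefevreMuller2015, §1.3 eq. (5)] -/
def eval (fl : ℚ → ℚ) : MulTree → ℚ
  | leaf a => a
  | node l r => fl (eval fl l * eval fl r)

/-- The number of floating-point multiplications (internal nodes); a tree with `n` leaves has
`n - 1` of them. [cite: GraillatLefevreMuller2015, §1.3] -/
def mults : MulTree → ℕ
  | leaf _ => 0
  | node l r => mults l + mults r + 1

/-- The number of factors `n`. [cite: GraillatLefevreMuller2015, §1.3] -/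
def size : MulTree → ℕ
  | leaf _ => 1
  | node l r => size l + size r

/-- `n` factors, `n - 1` multiplications. [cite: GraillatLefevreMuller2015, §1.3] -/
theorem size_eq_mults_add_one (T : MulTree) : T.size = T.mults + 1 := by
  induction T with
  | leaf a => rfl
  | node l r ihl ihr => simp only [size, mults, ihl, ihr]; ring

/-- The left-to-right product of eq. (5): `((a₁·a₂)·a₃)⋯aₙ`, accumulated onto a partial tree.
[cite: GraillatLefevreMuller2015, §1.3 eq. (5)] -/
def combAux : MulTree → List ℚ → MulTree
  | T, [] => T
  | T, b :: l => combAux (node T (leaf b)) l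

/-- The left-to-right product tree of `a₁, a₂, …, aₙ`. [cite: GraillatLefevreMuller2015, §1.3 eq. (5)] -/
def comb (a : ℚ) (l : List ℚ) : MulTree := combAux (leaf a) l

/-- Appending `l` adds `|l|` multiplications. [cite: GraillatLefevreMuller2015, §1.3 eq. (5)] -/
theorem combAux_mults (T : MulTree) (l : List ℚ) : (combAux T l).mults = T.mults + l.length := by
  induction l generalizing T with
  | nil => simp [combAux]
  | cons b l ih => simp only [combAux, ih, mults, List.length_cons]; ring

/-- Appending `l` multiplies the exact value by `l.prod`. [cite: GraillatLefevreMuller2015, §1.3 eq. (5)] -/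
theorem combAux_exact (T : MulTree) (l : List ℚ) : (combAux T l).exact = T.exact * l.prod := by
  induction l generalizing T with
  | nil => simp [combAux]
  | cons b l ih => simp only [combAux, ih, exact, List.prod_cons]; ring

/-- Appending `l` folds the rounded multiplications over `l`. [cite: GraillatLefevreMuller2015, §1.3 eq. (5)] -/
theorem combAux_eval (fl : ℚ → ℚ) (T : MulTree) (l : List ℚ) :
    (combAux T l).eval fl = l.foldl (fun y b => fl (y * b)) (T.eval fl) := by
  induction l generalizing T with
  | nil => simp [combAux]
  | cons b l ih => simp only [combAux, ih, eval, List.foldl_cons]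

/-- `n - 1` multiplications for `n` factors. [cite: GraillatLefevreMuller2015, §1.3 eq. (5)] -/
theorem comb_mults (a : ℚ) (l : List ℚ) : (comb a l).mults = l.length := by
  simp [comb, combAux_mults, mults]

/-- The exact value is `a₁ a₂ ⋯ aₙ`. [cite: GraillatLefevreMuller2015, §1.3] -/
theorem comb_exact (a : ℚ) (l : List ℚ) : (comb a l).exact = a * l.prod := by
  simp [comb, combAux_exact, exact]

/-- The computed value is the iterated product `RN(⋯RN(RN(a₁a₂)a₃)⋯aₙ)` of eq. (5).
[cite: GraillatLefevreMuller2015, §1.3 eq. (5)] -/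
theorem comb_eval (fl : ℚ → ℚ) (a : ℚ) (l : List ℚ) :
    (comb a l).eval fl = l.foldl (fun y b => fl (y * b)) a := by
  simp [comb, combAux_eval, eval]

end MulTree

/-- The multiplicative form behind Theorem 1, for an arbitrary per-operation relative error bound
`v ≤ 1` (`v = u` by eq. (3), `v = u/(1+u)` by the refined bound): `π̂ = θ·π` with
`(1-v)^{n-1} ≤ θ ≤ (1+v)^{n-1}`, `n - 1 =` the number of multiplications of the tree.
[cite: GraillatLefevreMuller2015, Thm 1] -/
theorem MulTree.exists_factor_eval {v : ℚ} (hv0 : 0 ≤ v) (hv1 : v ≤ 1)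
    (hfl : ∀ z : ℚ, |fl z - z| ≤ v * |z|) (T : MulTree) :
    ∃ θ : ℚ, T.eval fl = θ * T.exact ∧ (1 - v) ^ T.mults ≤ θ ∧ θ ≤ (1 + v) ^ T.mults := by
  -- one rounding as a factor in [1-v, 1+v]
  have one : ∀ z : ℚ, ∃ φ : ℚ, fl z = φ * z ∧ 1 - v ≤ φ ∧ φ ≤ 1 + v := by
    intro z
    have hb := hfl z
    rcases lt_trichotomy z 0 with hz | rfl | hz
    · rw [abs_of_neg hz] at hb
      obtain ⟨hb1, hb2⟩ := abs_le.mp hb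
      refine ⟨fl z / z, (div_mul_cancel₀ (fl z) hz.ne).symm, ?_, ?_⟩
      · rw [le_div_iff_of_neg hz]; linarith
      · rw [div_le_iff_of_neg hz]; linarith
    · have h0 : fl 0 = 0 := by simpa using hfl 0
      exact ⟨1, by simp [h0], by linarith, by linarith⟩
    · rw [abs_of_pos hz] at hb
      obtain ⟨hb1, hb2⟩ := abs_le.mp hb
      refine ⟨fl z / z, (div_mul_cancel₀ (fl z) hz.ne').symm, ?_, ?_⟩
      · rw [le_div_iff₀ hz]; linarith
      · rw [div_le_iff₀ hz]; linarith
  induction T with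
  | leaf a => exact ⟨1, by simp [MulTree.eval, MulTree.exact], by simp [MulTree.mults],
      by simp [MulTree.mults]⟩
  | node l r ihl ihr =>
    obtain ⟨θl, hl, hl1, hl2⟩ := ihl
    obtain ⟨θr, hr, hr1, hr2⟩ := ihr
    obtain ⟨φ, hφ, hφ1, hφ2⟩ := one (l.eval fl * r.eval fl)
    refine ⟨φ * (θl * θr), ?_, ?_, ?_⟩
    · simp only [MulTree.eval, MulTree.exact]; rw [hφ, hl, hr]; ring
    · have h1 : 0 ≤ 1 - v := by linarith
      calc (1 - v) ^ (l.node r).mults = (1 - v) * ((1 - v) ^ l.mults * (1 - v) ^ r.mults) := by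
            simp only [MulTree.mults]; ring
        _ ≤ φ * (θl * θr) := by
            apply mul_le_mul hφ1 (mul_le_mul hl1 hr1 (pow_nonneg h1 _) (le_trans (pow_nonneg h1 _) hl1))
              (mul_nonneg (pow_nonneg h1 _) (pow_nonneg h1 _)) (le_trans h1 hφ1)
    · have h1 : 0 ≤ 1 - v := by linarith
      have hθl : 0 ≤ θl := le_trans (pow_nonneg h1 _) hl1
      have hθr : 0 ≤ θr := le_trans (pow_nonneg h1 _) hr1
      have hφ0 : 0 ≤ φ := le_trans h1 hφ1
      calc φ * (θl * θr) ≤ (1 + v) * ((1 + v) ^ l.mults * (1 + v) ^ r.mults) := by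
            apply mul_le_mul hφ2 (mul_le_mul hl2 hr2 hθr (pow_nonneg (by linarith) _))
              (mul_nonneg hθl hθr) (by linarith)
        _ = (1 + v) ^ (l.node r).mults := by simp only [MulTree.mults]; ring

/-- **THEOREM 1** (folklore; Higham, Muller et al.; Rump), for any multiplication tree with `n`
factors and `n - 1` rounded multiplications, unbounded exponent range, round-to-nearest with any
tie rule: `π̂ = θ·π` with `(1-u)^{n-1} ≤ θ ≤ (1+u)^{n-1}`.
[cite: GraillatLefevreMuller2015, Thm 1 and §1.3] -/
theorem theorem1_tree (hp : 1 ≤ p) (hfl : IsRoundNearestU p fl) (T : MulTree) :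
    ∃ θ : ℚ, T.eval fl = θ * T.exact ∧
      (1 - unitRoundoff p) ^ T.mults ≤ θ ∧ θ ≤ (1 + unitRoundoff p) ^ T.mults :=
  MulTree.exists_factor_eval (u_pos (p := p)).le
    (le_trans (u_le_half hp) (by norm_num)) (abs_fl_sub_le_mul_abs hp hfl) T

/-- **THEOREM 1** as displayed (eq. (6)) for the left-to-right product `π̂ₙ` of `π ₙ = a₁a₂⋯aₙ`
(eq. (5)): `(1-u)^{n-1} πₙ ≤ π̂ₙ ≤ (1+u)^{n-1} πₙ` in the multiplicative form `π̂ₙ = θ πₙ`,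
`(1-u)^{n-1} ≤ θ ≤ (1+u)^{n-1}` (which is the displayed sandwich for `πₙ ≥ 0` and its mirror
image for `πₙ < 0`).  Here the factors are `a :: l`, `n - 1 = l.length`.
[cite: GraillatLefevreMuller2015, Thm 1 eq. (6)] -/
theorem theorem1 (hp : 1 ≤ p) (hfl : IsRoundNearestU p fl) (a : ℚ) (l : List ℚ) :
    ∃ θ : ℚ, l.foldl (fun y b => fl (y * b)) a = θ * (a * l.prod) ∧
      (1 - unitRoundoff p) ^ l.length ≤ θ ∧ θ ≤ (1 + unitRoundoff p) ^ l.length := by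
  obtain ⟨θ, h, h1, h2⟩ := theorem1_tree hp hfl (MulTree.comb a l)
  rw [MulTree.comb_eval, MulTree.comb_exact, MulTree.comb_mults] at *
  exact ⟨θ, h, h1, h2⟩

/-- `(1+v)^m + (1-v)^m ≥ 2`: the upper deviation `(1+v)^m - 1` dominates the lower one
`1 - (1-v)^m`. [cite: GraillatLefevreMuller2015, Thm 1] -/
theorem two_le_one_add_pow_add_one_sub_pow {v : ℚ} (hv0 : 0 ≤ v) (hv1 : v ≤ 1) (m : ℕ) :
    2 ≤ (1 + v) ^ m + (1 - v) ^ m := by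
  induction m with
  | zero => norm_num
  | succ m ih =>
    have h : (1 - v) ^ m ≤ (1 + v) ^ m := pow_le_pow_left₀ (by linarith) (by linarith) m
    have : (1 + v) ^ (m + 1) + (1 - v) ^ (m + 1)
        = ((1 + v) ^ m + (1 - v) ^ m) + v * ((1 + v) ^ m - (1 - v) ^ m) := by ring
    rw [this]
    nlinarith

/-- **THEOREM 1**, relative-error form: `|π̂ - π| ≤ ψ_{n-1} |π|` with `ψ_{n-1} = (1+u)^{n-1} - 1`.
[cite: GraillatLefevreMuller2015, Thm 1] -/
theorem theorem1_relErr (hp : 1 ≤ p) (hfl : IsRoundNearestU p fl) (T : MulTree) :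
    |T.eval fl - T.exact| ≤ ((1 + unitRoundoff p) ^ T.mults - 1) * |T.exact| := by
  obtain ⟨θ, h, h1, h2⟩ := theorem1_tree hp hfl T
  have hu0 := (u_pos (p := p)).le
  have hu1 : unitRoundoff p ≤ 1 := le_trans (u_le_half hp) (by norm_num)
  have h2' := two_le_one_add_pow_add_one_sub_pow hu0 hu1 T.mults
  rw [h, show θ * T.exact - T.exact = (θ - 1) * T.exact by ring, abs_mul]
  apply mul_le_mul_of_nonneg_right _ (abs_nonneg _)
  rw [abs_le]; constructor <;> linarith

/-- **THEOREM 1** with Higham's constant: `ψ_{n-1} ≤ γ_{n-1} = (n-1)u/(1-(n-1)u)`, so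
`|π̂ - π| ≤ γ_{n-1} |π|` as long as `(n-1)u < 1`. [cite: GraillatLefevreMuller2015, Thm 1] -/
theorem theorem1_gamma (hp : 1 ≤ p) (hfl : IsRoundNearestU p fl) (T : MulTree)
    (hn : (T.mults : ℚ) * unitRoundoff p < 1) :
    |T.eval fl - T.exact| ≤ Higham2002.gamma (unitRoundoff p) T.mults * |T.exact| := by
  have h := theorem1_relErr hp hfl T
  have hγ := Higham2002.one_add_pow_sub_one_le_gamma (u_pos (p := p)).le hn
  exact le_trans h (mul_le_mul_of_nonneg_right hγ (abs_nonneg _))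

/-- **REMARK 1**: `1 - (n-1)u ≤ (1-u)^{n-1}` for `u ≤ 1` (Bernoulli / Rump's induction), so the
lower bound of (6) may be replaced by `1 - (n-1)u`; consequently `-( n-1)u ≤ θ - 1`.
[cite: GraillatLefevreMuller2015, Remark 1] -/
theorem remark1 {u : ℚ} (hu1 : u ≤ 1) (m : ℕ) : 1 - (m : ℚ) * u ≤ (1 - u) ^ m :=
  Higham2002.one_sub_mul_le_one_sub_pow hu1 m

/-- **PROPERTY 1**: for `u > 0` and `1 ≤ k ≤ 3`, `(1 + u/(1+u))^k < 1 + k·u`.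
[cite: GraillatLefevreMuller2015, Property 1] -/
theorem property1 {u : ℚ} (hu : 0 < u) {k : ℕ} (hk1 : 1 ≤ k) (hk : k ≤ 3) :
    (1 + u / (1 + u)) ^ k < 1 + (k : ℚ) * u := by
  have h1u : (0 : ℚ) < 1 + u := by linarith
  have hw : 1 + u / (1 + u) = (1 + 2 * u) / (1 + u) := by field_simp; ring
  rw [hw, div_pow, div_lt_iff₀ (by positivity)]
  interval_cases k <;> push_cast <;> nlinarith [pow_pos hu 2, pow_pos hu 3, pow_pos hu 4,
    mul_pos hu (pow_pos hu 3)]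

/-- **PROPERTY 1**, the weak form for every `k ≤ 3` and `u ≥ 0`: `(1 + u/(1+u))^k ≤ 1 + k·u`.
[cite: GraillatLefevreMuller2015, Property 1] -/
theorem property1_le {u : ℚ} (hu : 0 ≤ u) {k : ℕ} (hk : k ≤ 3) :
    (1 + u / (1 + u)) ^ k ≤ 1 + (k : ℚ) * u := by
  have h1u : (0 : ℚ) < 1 + u := by linarith
  have hw : 1 + u / (1 + u) = (1 + 2 * u) / (1 + u) := by field_simp; ring
  rw [hw, div_pow, div_le_iff₀ (by positivity)]
  interval_cases k <;> push_cast <;> nlinarith [pow_nonneg hu 2, pow_nonneg hu 3, pow_nonneg hu 4,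
    mul_nonneg hu (pow_nonneg hu 3)]

/-- The consequence of Property 1 drawn in §1.3: with at most three rounded multiplications
(`n ≤ 4` factors) the relative error of the computed product is bounded by `(n-1)·u` — from the
refined per-operation bound `u/(1+u)` and `(1 + u/(1+u))^{n-1} ≤ 1 + (n-1)u`.
[cite: GraillatLefevreMuller2015, Property 1 and §1.3] -/
theorem relErr_le_of_mults_le_three (hp : 1 ≤ p) (hfl : IsRoundNearestU p fl) (T : MulTree)
    (hT : T.mults ≤ 3) :
    |T.eval fl - T.exact| ≤ (T.mults : ℚ) * unitRoundoff p * |T.exact| := by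
  have hu := u_pos (p := p)
  set v := unitRoundoff p / (1 + unitRoundoff p) with hv
  have hv0 : 0 ≤ v := div_nonneg hu.le (by linarith)
  have hvu : v ≤ unitRoundoff p := by
    rw [hv, div_le_iff₀ (by linarith)]; nlinarith
  have hv1 : v ≤ 1 := le_trans hvu (le_trans (u_le_half hp) (by norm_num))
  obtain ⟨θ, h, h1, h2⟩ :=
    MulTree.exists_factor_eval hv0 hv1 (abs_fl_sub_le_sharp hp hfl) T
  have hup : θ ≤ 1 + (T.mults : ℚ) * unitRoundoff p := le_trans h2 (property1_le hu.le hT)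
  have hlo : 1 - (T.mults : ℚ) * unitRoundoff p ≤ θ := by
    have := remark1 hv1 T.mults
    have : (T.mults : ℚ) * v ≤ (T.mults : ℚ) * unitRoundoff p :=
      mul_le_mul_of_nonneg_left hvu (Nat.cast_nonneg _)
    linarith
  rw [h, show θ * T.exact - T.exact = (θ - 1) * T.exact by ring, abs_mul]
  apply mul_le_mul_of_nonneg_right _ (abs_nonneg _)
  rw [abs_le]; constructor <;> linarith

/-! ### §2: the iterated-multiplication power algorithm and its error mechanism -/

/-- **ALGORITHM 1** (`naive-power(x, n)`): `x̂₁ = x`, `x̂ₖ = RN(x · x̂ₖ₋₁)`; `naivePower fl x n = x̂ₙ`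
(and `x̂₀ = 1`, unused). [cite: GraillatLefevreMuller2015, Algorithm 1] -/
def naivePower (fl : ℚ → ℚ) (x : ℚ) : ℕ → ℚ
  | 0 => 1
  | 1 => x
  | k + 2 => fl (x * naivePower fl x (k + 1))

/-- `x̂₁ = x`. [cite: GraillatLefevreMuller2015, Algorithm 1] -/
@[simp] theorem naivePower_one (fl : ℚ → ℚ) (x : ℚ) : naivePower fl x 1 = x := rfl

/-- `x̂ₖ₊₂ = RN(x·x̂ₖ₊₁)`. [cite: GraillatLefevreMuller2015, Algorithm 1] -/
theorem naivePower_succ_succ (fl : ℚ → ℚ) (x : ℚ) (k : ℕ) :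
    naivePower fl x (k + 2) = fl (x * naivePower fl x (k + 1)) := rfl

/-- Algorithm 1 is the left-to-right product (5) of `n` copies of `x` ("a special case of
iterative product"), up to the order of the two operands of each multiplication.
[cite: GraillatLefevreMuller2015, §1.3] -/
theorem naivePower_eq_foldl (fl : ℚ → ℚ) (x : ℚ) (k : ℕ) :
    naivePower fl x (k + 1) = (List.replicate k x).foldl (fun y b => fl (y * b)) x := by
  induction k with
  | zero => simp
  | succ k ih =>
    rw [naivePower_succ_succ, ih, List.replicate_succ', List.foldl_append]
    simp [mul_comm]

variable {x : ℚ}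

/-- `x̂ₖ > 0` for `x > 0`. [cite: GraillatLefevreMuller2015, §2] -/
theorem naivePower_pos (hp : 1 ≤ p) (hfl : IsRoundNearestU p fl) (hx : 0 < x) :
    ∀ k : ℕ, 0 < naivePower fl x (k + 1)
  | 0 => by simpa using hx
  | k + 1 => by
    rw [naivePower_succ_succ]
    exact fl_pos hp hfl (mul_pos hx (naivePower_pos hp hfl hx k))

/-- One step of Algorithm 1 is one rounding: `(1-u)·x·x̂ₖ ≤ x̂ₖ₊₁ ≤ (1+u)·x·x̂ₖ`.
[cite: GraillatLefevreMuller2015, §2 eq. (4)] -/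
theorem naivePower_step_bounds (hp : 1 ≤ p) (hfl : IsRoundNearestU p fl) (hx : 0 < x) (k : ℕ) :
    (1 - unitRoundoff p) * (x * naivePower fl x (k + 1)) ≤ naivePower fl x (k + 2) ∧
      naivePower fl x (k + 2) ≤ (1 + unitRoundoff p) * (x * naivePower fl x (k + 1)) := by
  rw [naivePower_succ_succ]
  obtain ⟨φ, h, h1, h2⟩ := exists_factor_fl hp hfl (x * naivePower fl x (k + 1))
  have hs : 0 < x * naivePower fl x (k + 1) := mul_pos hx (naivePower_pos hp hfl hx k)
  rw [h]
  exact ⟨mul_le_mul_of_nonneg_right h1 hs.le, mul_le_mul_of_nonneg_right h2 hs.le⟩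

/-- Theorem 1 for Algorithm 1, upper half: `x̂ₖ ≤ (1+u)^{k-1} x^k`. [cite: GraillatLefevreMuller2015, Thm 1] -/
theorem naivePower_le (hp : 1 ≤ p) (hfl : IsRoundNearestU p fl) (hx : 0 < x) :
    ∀ k : ℕ, naivePower fl x (k + 1) ≤ (1 + unitRoundoff p) ^ k * x ^ (k + 1)
  | 0 => by simp
  | k + 1 => by
    have ih := naivePower_le hp hfl hx k
    have h := (naivePower_step_bounds hp hfl hx k).2
    have hu := u_pos (p := p)
    calc naivePower fl x (k + 2) ≤ (1 + unitRoundoff p) * (x * naivePower fl x (k + 1)) := h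
      _ ≤ (1 + unitRoundoff p) * (x * ((1 + unitRoundoff p) ^ k * x ^ (k + 1))) := by
          gcongr
      _ = (1 + unitRoundoff p) ^ (k + 1) * x ^ (k + 2) := by ring

/-- Theorem 1 for Algorithm 1, lower half: `(1-u)^{k-1} x^k ≤ x̂ₖ`. [cite: GraillatLefevreMuller2015, Thm 1] -/
theorem le_naivePower (hp : 1 ≤ p) (hfl : IsRoundNearestU p fl) (hx : 0 < x) :
    ∀ k : ℕ, (1 - unitRoundoff p) ^ k * x ^ (k + 1) ≤ naivePower fl x (k + 1)
  | 0 => by simp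
  | k + 1 => by
    have ih := le_naivePower hp hfl hx k
    have h := (naivePower_step_bounds hp hfl hx k).1
    have hu1 : 0 ≤ 1 - unitRoundoff p := by linarith [u_le_half hp]
    calc (1 - unitRoundoff p) ^ (k + 1) * x ^ (k + 2)
        = (1 - unitRoundoff p) * (x * ((1 - unitRoundoff p) ^ k * x ^ (k + 1))) := by ring
      _ ≤ (1 - unitRoundoff p) * (x * naivePower fl x (k + 1)) := by gcongr
      _ ≤ naivePower fl x (k + 2) := h

/-- The mechanism of Remarks 2–3: if ONE step `x̂ⱼ₊₂ = RN(x·x̂ⱼ₊₁)` has relative excess at most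
`c` (instead of `u`), every later `x̂ₘ` (`m = i+2 ≥ j+2`) satisfies
`x̂ₘ ≤ (1+u)^{m-2} (1+c) x^m` — one factor `1+u` of Theorem 1 is traded for `1+c`.
[cite: GraillatLefevreMuller2015, Remarks 2–3] -/
theorem naivePower_le_of_step (hp : 1 ≤ p) (hfl : IsRoundNearestU p fl) (hx : 0 < x) {c : ℚ}
    (hc : 0 ≤ c) {j : ℕ}
    (hstep : naivePower fl x (j + 2) ≤ (1 + c) * (x * naivePower fl x (j + 1))) :
    ∀ i : ℕ, j ≤ i → naivePower fl x (i + 2) ≤ (1 + unitRoundoff p) ^ i * (1 + c) * x ^ (i + 2) := by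
  have hu := u_pos (p := p)
  intro i hi
  induction i, hi using Nat.le_induction with
  | base =>
    calc naivePower fl x (j + 2) ≤ (1 + c) * (x * naivePower fl x (j + 1)) := hstep
      _ ≤ (1 + c) * (x * ((1 + unitRoundoff p) ^ j * x ^ (j + 1))) := by
          gcongr; exact naivePower_le hp hfl hx j
      _ = (1 + unitRoundoff p) ^ j * (1 + c) * x ^ (j + 2) := by ring
  | succ i hi ih =>
    calc naivePower fl x (i + 1 + 2) ≤ (1 + unitRoundoff p) * (x * naivePower fl x (i + 2)) :=
          (naivePower_step_bounds hp hfl hx (i + 1)).2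
      _ ≤ (1 + unitRoundoff p) * (x * ((1 + unitRoundoff p) ^ i * (1 + c) * x ^ (i + 2))) := by
          gcongr
      _ = (1 + unitRoundoff p) ^ (i + 1) * (1 + c) * x ^ (i + 1 + 2) := by ring

/-- A step whose argument `x·x̂ⱼ₊₁` has significand at least `1+a` (`(1+a)2^e ≤ x·x̂ⱼ₊₁ < 2^{e+1}`)
has relative excess at most `u/(1+a)`, by Lemma 1. [cite: GraillatLefevreMuller2015, Lemma 1, Remark 3] -/
theorem fl_le_of_sig (hp : 1 ≤ p) (hfl : IsRoundNearestU p fl) {s a : ℚ} (ha : 0 ≤ a) {e : ℕ}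
    (h1 : (1 + a) * (2 : ℚ) ^ e ≤ s) (h2 : s < (2 : ℚ) ^ (e + 1)) :
    fl s ≤ (1 + unitRoundoff p / (1 + a)) * s := by
  have he : ((e : ℤ) + 1) = ((e + 1 : ℕ) : ℤ) := by push_cast; ring
  have h := lemma1 hp hfl (e := (e : ℤ)) (w := 1 + a) (t := s) (by linarith)
    (by rwa [zpow_natCast]) (by rw [he, zpow_natCast]; exact h2)
  have := (abs_le.mp h).2
  linarith

/-- An exp-free form of the estimate behind Lemma 2: for `m²u ≤ 1`,
`(1+u)^m ≤ 1 + m u + m² u²/2`. [cite: GraillatLefevreMuller2015, Lemma 2] -/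
theorem one_add_pow_le_quadratic {u : ℚ} (hu : 0 ≤ u) :
    ∀ {m : ℕ}, (m : ℚ) ^ 2 * u ≤ 1 → (1 + u) ^ m ≤ 1 + (m : ℚ) * u + (m : ℚ) ^ 2 * u ^ 2 / 2
  | 0, _ => by simp
  | m + 1, hm => by
    push_cast at hm ⊢
    have hm' : (m : ℚ) ^ 2 * u ≤ 1 := by nlinarith [Nat.cast_nonneg (α := ℚ) m]
    have ih := one_add_pow_le_quadratic hu hm'
    calc (1 + u) ^ (m + 1) = (1 + u) ^ m * (1 + u) := pow_succ _ _
      _ ≤ (1 + (m : ℚ) * u + (m : ℚ) ^ 2 * u ^ 2 / 2) * (1 + u) :=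
          mul_le_mul_of_nonneg_right ih (by linarith)
      _ ≤ 1 + ((m : ℚ) + 1) * u + ((m : ℚ) + 1) ^ 2 * u ^ 2 / 2 := by
          nlinarith [mul_le_mul_of_nonneg_left hm' (sq_nonneg u)]

/-- **LEMMA 2**: if `0 ≤ u ≤ 2/(3n²)` (here: `n²u ≤ 2/3`, `n ≥ 2`) then
`(1+u)^{n-2} · (1 + u/(1+n²u)) ≤ 1 + (n-1)·u`.  (The paper expands a 13-term polynomial; we
bound `(1+u)^{n-2}` by `1 + (n-2)u + (n-2)²u²/2` instead — a different derivation of the same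
statement.) [cite: GraillatLefevreMuller2015, Lemma 2] -/
theorem lemma2 {u : ℚ} {n : ℕ} (hn : 2 ≤ n) (hu : 0 ≤ u) (ha : (n : ℚ) ^ 2 * u ≤ 2 / 3) :
    (1 + u) ^ (n - 2) * (1 + u / (1 + (n : ℚ) ^ 2 * u)) ≤ 1 + ((n : ℚ) - 1) * u := by
  obtain ⟨m, rfl⟩ : ∃ m, n = m + 2 := ⟨n - 2, by omega⟩
  rw [Nat.add_sub_cancel]
  push_cast at ha ⊢
  have hm0 : (0 : ℚ) ≤ m := Nat.cast_nonneg m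
  have hB : (m : ℚ) ^ 2 * u ≤ 2 / 3 := by nlinarith
  have hA : (m : ℚ) ^ 2 * (((m : ℚ) + 2) ^ 2 * u) ≤ (m : ℚ) ^ 2 * (2 / 3) :=
    mul_le_mul_of_nonneg_left ha (sq_nonneg _)
  have h1 := one_add_pow_le_quadratic hu (m := m) (by linarith)
  have h1a : (0 : ℚ) < 1 + ((m : ℚ) + 2) ^ 2 * u := by positivity
  have hC : (m : ℚ) ^ 2 / 2 * (1 + ((m : ℚ) + 2) ^ 2 * u) + m + (m : ℚ) ^ 2 * u / 2
      ≤ ((m : ℚ) + 2) ^ 2 := by nlinarith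
  calc (1 + u) ^ m * (1 + u / (1 + ((m : ℚ) + 2) ^ 2 * u))
      ≤ (1 + (m : ℚ) * u + (m : ℚ) ^ 2 * u ^ 2 / 2) * (1 + u / (1 + ((m : ℚ) + 2) ^ 2 * u)) :=
        mul_le_mul_of_nonneg_right h1 (by positivity)
    _ = (1 + (m : ℚ) * u + (m : ℚ) ^ 2 * u ^ 2 / 2) * (1 + ((m : ℚ) + 2) ^ 2 * u + u)
          / (1 + ((m : ℚ) + 2) ^ 2 * u) := by
        field_simp
    _ ≤ 1 + ((m : ℚ) + 2 - 1) * u := by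
        rw [div_le_iff₀ h1a]
        nlinarith [mul_le_mul_of_nonneg_left hC (sq_nonneg u)]

/-- **LEMMA 2** with the paper's hypothesis `u ≤ 2/(3n²)` verbatim. [cite: GraillatLefevreMuller2015, Lemma 2] -/
theorem lemma2' {u : ℚ} {n : ℕ} (hn : 2 ≤ n) (hu : 0 ≤ u) (hu' : u ≤ 2 / (3 * (n : ℚ) ^ 2)) :
    (1 + u) ^ (n - 2) * (1 + u / (1 + (n : ℚ) ^ 2 * u)) ≤ 1 + ((n : ℚ) - 1) * u := by
  have hn0 : (0 : ℚ) < (n : ℚ) ^ 2 := by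
    have : (2 : ℚ) ≤ n := by exact_mod_cast hn
    positivity
  refine lemma2 hn hu ?_
  rw [le_div_iff₀ (by positivity)] at hu'
  linarith

/-- **REMARK 2**: assume `n²u ≤ 2/3` (`n ≤ √(2/3)·2^{p/2}`); if for some step `2 ≤ k ≤ n` the
rounding was downward, `x̂ₖ = RN(x·x̂ₖ₋₁) ≤ x·x̂ₖ₋₁`, then `x̂ₙ ≤ (1 + (n-1)u)·xⁿ`.
(Indices: `k = j+2`, `n = i+2`.) [cite: GraillatLefevreMuller2015, Remark 2] -/
theorem remark2 (hp : 1 ≤ p) (hfl : IsRoundNearestU p fl) (hx : 0 < x) {j i : ℕ} (hji : j ≤ i)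
    (ha : ((i : ℚ) + 2) ^ 2 * unitRoundoff p ≤ 2 / 3)
    (hdown : naivePower fl x (j + 2) ≤ x * naivePower fl x (j + 1)) :
    naivePower fl x (i + 2) ≤ (1 + ((i : ℚ) + 1) * unitRoundoff p) * x ^ (i + 2) := by
  have hu := u_pos (p := p)
  set a := ((i : ℚ) + 2) ^ 2 * unitRoundoff p with ha_def
  have ha0 : 0 ≤ a := by positivity
  have hc : 0 ≤ unitRoundoff p / (1 + a) := div_nonneg hu.le (by linarith)
  have hstep : naivePower fl x (j + 2) ≤ (1 + unitRoundoff p / (1 + a)) * (x * naivePower fl x (j + 1)) := by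
    have hs : 0 ≤ x * naivePower fl x (j + 1) := (mul_pos hx (naivePower_pos hp hfl hx j)).le
    nlinarith
  have h := naivePower_le_of_step hp hfl hx hc hstep i hji
  have hL := lemma2 (n := i + 2) (u := unitRoundoff p) (by omega) hu.le (by push_cast; exact ha)
  rw [Nat.add_sub_cancel] at hL
  push_cast at hL
  have hxn : 0 < x ^ (i + 2) := pow_pos hx _
  calc naivePower fl x (i + 2) ≤ (1 + unitRoundoff p) ^ i * (1 + unitRoundoff p / (1 + a)) * x ^ (i + 2) := h
    _ ≤ (1 + ((i : ℚ) + 2 - 1) * unitRoundoff p) * x ^ (i + 2) := mul_le_mul_of_nonneg_right hL hxn.le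
    _ = (1 + ((i : ℚ) + 1) * unitRoundoff p) * x ^ (i + 2) := by ring

/-- **REMARK 3**: assume `n²u ≤ 2/3`; if for some `1 ≤ k ≤ n-1` the significand of `x·x̂ₖ` is at
least `1 + n²u` (`(1+n²u)·2^e ≤ x·x̂ₖ < 2^{e+1}`), then `x̂ₙ ≤ (1 + (n-1)u)·xⁿ` (Lemma 1 at that
step, Theorem 1 at the others, Lemma 2). (Indices: `k = j+1`, `n = i+2`.)
[cite: GraillatLefevreMuller2015, Remark 3] -/
theorem remark3 (hp : 1 ≤ p) (hfl : IsRoundNearestU p fl) (hx : 0 < x) {j i : ℕ} (hji : j ≤ i)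
    (ha : ((i : ℚ) + 2) ^ 2 * unitRoundoff p ≤ 2 / 3) {e : ℕ}
    (h1 : (1 + ((i : ℚ) + 2) ^ 2 * unitRoundoff p) * (2 : ℚ) ^ e ≤ x * naivePower fl x (j + 1))
    (h2 : x * naivePower fl x (j + 1) < (2 : ℚ) ^ (e + 1)) :
    naivePower fl x (i + 2) ≤ (1 + ((i : ℚ) + 1) * unitRoundoff p) * x ^ (i + 2) := by
  have hu := u_pos (p := p)
  set a := ((i : ℚ) + 2) ^ 2 * unitRoundoff p with ha_def
  have ha0 : 0 ≤ a := by positivity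
  have hc : 0 ≤ unitRoundoff p / (1 + a) := div_nonneg hu.le (by linarith)
  have hstep : naivePower fl x (j + 2) ≤ (1 + unitRoundoff p / (1 + a)) * (x * naivePower fl x (j + 1)) := by
    rw [naivePower_succ_succ]; exact fl_le_of_sig hp hfl ha0 h1 h2
  have h := naivePower_le_of_step hp hfl hx hc hstep i hji
  have hL := lemma2 (n := i + 2) (u := unitRoundoff p) (by omega) hu.le (by push_cast; exact ha)
  rw [Nat.add_sub_cancel] at hL
  push_cast at hL
  have hxn : 0 < x ^ (i + 2) := pow_pos hx _
  calc naivePower fl x (i + 2) ≤ (1 + unitRoundoff p) ^ i * (1 + unitRoundoff p / (1 + a)) * x ^ (i + 2) := h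
    _ ≤ (1 + ((i : ℚ) + 2 - 1) * unitRoundoff p) * x ^ (i + 2) := mul_le_mul_of_nonneg_right hL hxn.le
    _ = (1 + ((i : ℚ) + 1) * unitRoundoff p) * x ^ (i + 2) := by ring

/-- Powers of two with natural exponent are floats. [cite: GraillatLefevreMuller2015, §1.1] -/
theorem isFloatU_two_pow (hp : 1 ≤ p) (j : ℕ) : IsFloatU p ((2 : ℚ) ^ j) := by
  simpa using isFloatU_zpow hp (j : ℤ)

/-- Floats in `[1, 2)` lie on the grid `2u·ℤ = 2^{1-p}ℤ`: `x = M · 2^{1-p}`.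
[cite: GraillatLefevreMuller2015, §3 ("x = 1 + k·2^{-p+1}")] -/
theorem exists_int_mul_of_one_le (hp : 1 ≤ p) {x : ℚ} (hx : IsFloatU p x) (h1 : 1 ≤ x) :
    ∃ M : ℤ, x = (M : ℚ) * (2 : ℚ) ^ ((0 : ℤ) + 1 - p) := by
  rcases lt_or_eq_of_le h1 with hgt | heq
  · exact exists_int_mul_of_lt hx (k := 0) (by simpa using hgt)
  · refine ⟨2 ^ (p - 1), ?_⟩
    have hp1 : (((p - 1 : ℕ) : ℤ)) = (p : ℤ) - 1 := by omega
    rw [← heq]; push_cast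
    rw [← zpow_natCast, ← zpow_add₀ (by norm_num : (2 : ℚ) ≠ 0), hp1]
    simp

/-- **LEMMA 3**: if `x = 1 + k·2^{1-p} ∈ F ∩ [1,2)` with `k < 2^{p/2-1}` — equivalently
`(x-1)² < u` — then `x̂₂ = RN(x²) = 1 + 2k·2^{1-p} = 2x - 1` exactly (which is `< x²` for
`x > 1`: the first rounding is downward and Remark 2 applies). Any tie rule; `p ≥ 2`.
[cite: GraillatLefevreMuller2015, Lemma 3] -/
theorem lemma3 (hp : 2 ≤ p) (hfl : IsRoundNearestU p fl) (hx : IsFloatU p x) (h1 : 1 ≤ x)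
    (hδ : (x - 1) ^ 2 < unitRoundoff p) : fl (x * x) = 2 * x - 1 := by
  have hp1 : 1 ≤ p := le_trans (by norm_num) hp
  have hu := u_pos (p := p)
  have hu4 : unitRoundoff p ≤ 1 / 4 := by
    unfold unitRoundoff
    have : (2 : ℚ) ^ 2 ≤ 2 ^ p := pow_le_pow_right₀ (by norm_num) hp
    rw [div_le_div_iff₀ (by positivity) (by norm_num)]
    linarith
  set δ := x - 1 with hδ_def
  have hδ0 : 0 ≤ δ := by linarith
  have hδh : δ < 1 / 2 := by nlinarith
  -- the grid 2u ℤ on [1, 2)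
  have hc : (2 : ℚ) ^ ((0 : ℤ) + 1 - p) = 2 * unitRoundoff p := by
    unfold unitRoundoff
    rw [show ((0 : ℤ) + 1 - p) = 1 + -(p : ℤ) by ring, zpow_add₀ (by norm_num), zpow_neg,
      zpow_natCast]
    ring
  obtain ⟨M, hM⟩ := exists_int_mul_of_one_le hp1 hx h1
  rw [hc] at hM
  -- g := 2x - 1 = 1 + 2δ is a float (an integer multiple of 2u below 2)
  have hpow : (2 : ℚ) ^ (p - 1) * 2 = 2 ^ p := by rw [← pow_succ, Nat.sub_add_cancel hp1]
  have h2u1 : (2 : ℚ) ^ (p - 1) * (2 * unitRoundoff p) = 1 := by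
    unfold unitRoundoff; rw [← mul_assoc, hpow]; field_simp
  have hg_eq : 2 * x - 1 = ((2 * M - (2 ^ (p - 1) : ℕ) : ℤ) : ℚ) * (2 : ℚ) ^ ((0 : ℤ) + 1 - p) := by
    rw [hc]; push_cast; rw [sub_mul, h2u1, hM]; ring
  have h2u : 0 < 2 * unitRoundoff p := by linarith
  have h2p : ((2 ^ p : ℤ) : ℚ) * (2 * unitRoundoff p) = 2 := by
    unfold unitRoundoff; push_cast; field_simp
  set N : ℤ := 2 * M - (2 ^ (p - 1) : ℕ) with hN
  have hg : IsFloatU p (2 * x - 1) := by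
    rw [hg_eq]
    refine isFloatU_int_mul_zpow ?_ _
    have hgq : 2 * x - 1 = (N : ℚ) * (2 * unitRoundoff p) := by rw [hg_eq, hc]
    have hN0 : (0 : ℚ) < N := by
      have h0 : (0 : ℚ) < (N : ℚ) * (2 * unitRoundoff p) := by rw [← hgq]; linarith
      exact (mul_pos_iff_of_pos_right h2u).mp h0
    have hN1 : (N : ℚ) < ((2 ^ p : ℤ) : ℚ) := by
      have h0 : (N : ℚ) * (2 * unitRoundoff p) < ((2 ^ p : ℤ) : ℚ) * (2 * unitRoundoff p) := by
        rw [← hgq, h2p]; linarith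
      exact lt_of_mul_lt_mul_right h0 h2u.le
    have hN0' : (0 : ℤ) < N := by exact_mod_cast hN0
    have hN1' : N < (2 ^ p : ℤ) := by exact_mod_cast hN1
    rw [abs_of_pos hN0']; exact hN1'
  -- x² = g + δ² with g = 2x - 1 ∈ F, and every float above g is ≥ g + 2u, hence farther from x²
  have hs : x * x = (2 * x - 1) + δ ^ 2 := by rw [hδ_def]; ring
  have hge : 2 * x - 1 ≤ fl (x * x) := le_fl_of_isFloatU_le hfl hg (by rw [hs]; nlinarith)
  rcases lt_or_eq_of_le hge with hgt | heq
  · exfalso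
    have h1g : (2 : ℚ) ^ (0 : ℤ) < fl (x * x) := by simp; linarith
    obtain ⟨N', hN'⟩ := exists_int_mul_of_lt (hfl (x * x)).1 h1g
    rw [hc] at hN'
    have hgq : 2 * x - 1 = (N : ℚ) * (2 * unitRoundoff p) := by rw [hg_eq, hc]
    have hNN : N + 1 ≤ N' := by
      have : (N : ℚ) < N' := by
        have h0 : (N : ℚ) * (2 * unitRoundoff p) < (N' : ℚ) * (2 * unitRoundoff p) := by
          rw [← hgq, ← hN']; exact hgt
        exact lt_of_mul_lt_mul_right h0 h2u.le
      have : N < N' := by exact_mod_cast this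
      omega
    have hfar : 2 * x - 1 + 2 * unitRoundoff p ≤ fl (x * x) := by
      have h0 : ((N + 1 : ℤ) : ℚ) * (2 * unitRoundoff p) ≤ (N' : ℚ) * (2 * unitRoundoff p) :=
        mul_le_mul_of_nonneg_right (by exact_mod_cast hNN) h2u.le
      push_cast at h0
      rw [hgq, hN']; linarith
    have hnear := (hfl (x * x)).2 _ hg
    have hR : |x * x - (2 * x - 1)| = δ ^ 2 := by
      rw [hs, show 2 * x - 1 + δ ^ 2 - (2 * x - 1) = δ ^ 2 by ring, abs_of_nonneg (sq_nonneg δ)]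
    have hL : |x * x - fl (x * x)| = fl (x * x) - x * x := by
      rw [abs_of_nonpos (by linarith), neg_sub]
    rw [hR, hL] at hnear
    linarith
  · exact heq.symm

/-! ### §3: proof of Theorem 2 -/

/-- `(1 + n²u)³ ≤ 2` (i.e. `n ≤ β·2^{p/2}`, `β = √(2^{1/3}-1)`) forces `n²u ≤ 1/3 ≤ 2/3`, so
Lemma 2 and Remarks 2–3 apply. [cite: GraillatLefevreMuller2015, Thm 2] -/
theorem le_third_of_cube_le_two {a : ℚ} (ha : 0 ≤ a) (h : (1 + a) ^ 3 ≤ 2) : a ≤ 1 / 3 := by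
  nlinarith [sq_nonneg a, mul_nonneg ha (sq_nonneg a)]

/-- The growth comparison used in §3.2 (`2^{2t/3}(1+u)^{t-2} < 2^{t-1}` for `t ≥ 4`, `p ≥ 5`), in
the integer form `(1+u)^{3(i+2)} ≤ 2^{i+1}`. [cite: GraillatLefevreMuller2015, §3.2] -/
theorem one_add_pow_three_mul_le {u : ℚ} (hu0 : 0 ≤ u) (hu : u ≤ 1 / 32) :
    ∀ i : ℕ, (1 + u) ^ (3 * (i + 2)) ≤ (2 : ℚ) ^ (i + 1)
  | 0 => by
    have h : (1 + u) ^ 6 ≤ ((33 : ℚ) / 32) ^ 6 := pow_le_pow_left₀ (by linarith) (by linarith) 6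
    norm_num at h ⊢
    linarith
  | i + 1 => by
    have ih := one_add_pow_three_mul_le hu0 hu i
    have h3 : (1 + u) ^ 3 ≤ ((33 : ℚ) / 32) ^ 3 := pow_le_pow_left₀ (by linarith) (by linarith) 3
    have h3' : (1 + u) ^ 3 ≤ 2 := le_trans h3 (by norm_num)
    have e1 : (1 + u) ^ (3 * (i + 1 + 2)) = (1 + u) ^ (3 * (i + 2)) * (1 + u) ^ 3 := by ring
    have e2 : (2 : ℚ) ^ (i + 1 + 1) = 2 ^ (i + 1) * 2 := by ring
    rw [e1, e2]
    exact mul_le_mul ih h3' (by positivity) (by positivity)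

/-- Discrete crossing: a property false at `0` and true at `i` switches on at some `j < i`.
(Replaces the paper's "let `k` be the minimal index such that …".) [cite: GraillatLefevreMuller2015, §3.1–3.2] -/
theorem exists_cross {Q : ℕ → Prop} : ∀ {i : ℕ}, ¬ Q 0 → Q i → ∃ j, j < i ∧ ¬ Q j ∧ Q (j + 1)
  | 0, h0, hi => absurd hi h0
  | i + 1, h0, hi => by
    by_cases h : Q i
    · obtain ⟨j, hj, hq, hq'⟩ := exists_cross h0 h
      exact ⟨j, by omega, hq, hq'⟩
    · exact ⟨i, by omega, h, hi⟩

/-- **THEOREM 2, upper half, for `1 ≤ x < 2`** (the heart of §3): if `p ≥ 5` and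
`(1 + n²u)³ ≤ 2` then `x̂ₙ ≤ (1 + (n-1)u)·xⁿ` (`n = i+2 ≥ 2`).  Proof as in the paper: either
Lemma 3 applies (first rounding downward), or one finds a step whose argument has significand
`≥ 1 + n²u` (cases `x² ≤ 1+n²u` / `1+n²u < x² < 2` / `x² ≥ 2` of §3.1–3.3), or a downward
rounding at a power of two; then Remarks 2–3. [cite: GraillatLefevreMuller2015, Thm 2, §3] -/
theorem naivePower_le_upper (hp : 5 ≤ p) (hfl : IsRoundNearestU p fl) (hx : IsFloatU p x)
    (h1 : 1 ≤ x) (h2 : x < 2) (i : ℕ)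
    (hβ : (1 + ((i : ℚ) + 2) ^ 2 * unitRoundoff p) ^ 3 ≤ 2) :
    naivePower fl x (i + 2) ≤ (1 + ((i : ℚ) + 1) * unitRoundoff p) * x ^ (i + 2) := by
  have hp1 : 1 ≤ p := le_trans (by norm_num) hp
  have hp2 : 2 ≤ p := le_trans (by norm_num) hp
  have hu := u_pos (p := p)
  have hu32 := unitRoundoff_le_of_five_le hp
  have hx0 : 0 < x := by linarith
  set u := unitRoundoff p with hu_def
  set a := ((i : ℚ) + 2) ^ 2 * u with ha_def
  have ha0 : 0 ≤ a := by positivity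
  have ha3 : a ≤ 1 / 3 := le_third_of_cube_le_two ha0 hβ
  have ha23 : a ≤ 2 / 3 := by linarith
  -- n = 2 is one rounding
  rcases Nat.eq_zero_or_pos i with rfl | hipos
  · have h := (naivePower_step_bounds hp1 hfl hx0 0).2
    simp only [naivePower_one, Nat.cast_zero, zero_add] at h ⊢
    have e : (1 + 1 * u) * x ^ 2 = (1 + u) * (x * x) := by ring
    rw [e]; exact h
  -- n ≥ 3.  Suppose the conclusion fails; then (Remark 2) no step up to `n` rounds downward and
  -- (Remark 3) no argument `x·x̂ⱼ₊₁`, `j ≤ i`, has significand ≥ 1+a.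
  by_contra hG
  have nodown : ∀ j, j ≤ i → x * naivePower fl x (j + 1) < naivePower fl x (j + 2) := by
    intro j hj
    by_contra h
    push Not at h
    exact hG (remark2 hp1 hfl hx0 hj ha23 h)
  have nosig : ∀ j, j ≤ i → ∀ e : ℕ, (1 + a) * (2 : ℚ) ^ e ≤ x * naivePower fl x (j + 1) →
      x * naivePower fl x (j + 1) < (2 : ℚ) ^ (e + 1) → False := by
    intro j hj e he1 he2
    exact hG (remark3 hp1 hfl hx0 hj ha23 he1 he2)
  -- hence `x̂ₖ ≥ x^k` all along
  have hpow_le : ∀ j, j ≤ i + 1 → x ^ (j + 1) ≤ naivePower fl x (j + 1) := by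
    intro j hj
    induction j with
    | zero => simp
    | succ j ih =>
      have h := nodown j (by omega)
      have ih' := ih (by omega)
      calc x ^ (j + 1 + 1) = x * x ^ (j + 1) := by ring
        _ ≤ x * naivePower fl x (j + 1) := by gcongr
        _ ≤ naivePower fl x (j + 2) := h.le
  by_cases hL3 : (x - 1) ^ 2 < u
  · -- Lemma 3: the first rounding is exact and downward, `x̂₂ = 2x - 1 ≤ x²`
    have h3 := lemma3 hp2 hfl hx h1 hL3
    have h := nodown 0 (by omega)
    rw [naivePower_succ_succ, naivePower_one, h3] at h
    have h0 : 0 ≤ (x - 1) ^ 2 := sq_nonneg _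
    linarith
  push Not at hL3
  by_cases hA : x * x ≤ 1 + a
  · -- §3.1: x² ≤ 1 + n²u.  Then x ≥ 1 + n u and xⁿ ≥ 1 + n²u.
    have hnu : ((i : ℚ) + 2) * u ≤ x - 1 := by
      have hsq : (((i : ℚ) + 2) * u) ^ 2 ≤ (x - 1) ^ 2 := by
        have e : (((i : ℚ) + 2) * u) ^ 2 = a * u := by rw [ha_def]; ring
        have hau : a * u ≤ 1 / 3 * u := mul_le_mul_of_nonneg_right ha3 hu.le
        rw [e]; linarith
      exact (pow_le_pow_iff_left₀ (by positivity) (by linarith) two_ne_zero).mp hsq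
    have hxn : 1 + a ≤ x ^ (i + 2) := by
      have hν : (0 : ℚ) ≤ ((i : ℚ) + 2) * u := by positivity
      have hB := one_add_mul_le_pow (a := ((i : ℚ) + 2) * u) (by linarith) (i + 2)
      have hM : (1 + ((i : ℚ) + 2) * u) ^ (i + 2) ≤ x ^ (i + 2) :=
        pow_le_pow_left₀ (by positivity) (by linarith) (i + 2)
      push_cast at hB
      calc 1 + a = 1 + ((i : ℚ) + 2) * (((i : ℚ) + 2) * u) := by rw [ha_def]; ring
        _ ≤ _ := hB
        _ ≤ _ := hM
    have hs : 1 + a ≤ x * naivePower fl x (i + 1) := by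
      calc 1 + a ≤ x ^ (i + 2) := hxn
        _ = x * x ^ (i + 1) := by ring
        _ ≤ x * naivePower fl x (i + 1) := by gcongr; exact hpow_le i (by omega)
    by_cases hs2 : x * naivePower fl x (i + 1) < 2
    · exact nosig i le_rfl 0 (by simpa using hs) (by simpa using hs2)
    · -- the first index where `x·x̂` reaches 2: just before it the significand is ≥ 1+a
      have hQ0 : ¬ (2 ≤ x * naivePower fl x (0 + 1)) := by
        simp only [zero_add, naivePower_one, not_le]; linarith
      obtain ⟨j, hji, hQj, hQj1⟩ :=
        exists_cross (Q := fun j => 2 ≤ x * naivePower fl x (j + 1)) hQ0 (not_lt.mp hs2)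
      simp only [not_le] at hQj
      have hstep := (naivePower_step_bounds hp1 hfl hx0 j).2
      have hsq : ((1 + a) * (1 + u) * x) ^ 2 ≤ 2 ^ 2 := by
        have huu : u * u ≤ 1 / 32 * (1 / 32) := mul_le_mul hu32 hu32 hu.le (by norm_num)
        have h1u : (1 + u) ^ 2 ≤ 2 := by nlinarith
        calc ((1 + a) * (1 + u) * x) ^ 2 = (1 + a) ^ 2 * (x * x) * (1 + u) ^ 2 := by ring
          _ ≤ (1 + a) ^ 2 * (1 + a) * 2 := by gcongr
          _ = (1 + a) ^ 3 * 2 := by ring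
          _ ≤ 2 * 2 := by nlinarith
          _ = 2 ^ 2 := by norm_num
      have hle2 : (1 + a) * (1 + u) * x ≤ 2 :=
        (pow_le_pow_iff_left₀ (by positivity) (by norm_num) two_ne_zero).mp hsq
      have hsig : 1 + a ≤ x * naivePower fl x (j + 1) := by
        -- 2 ≤ x·x̂ⱼ₊₂ ≤ (1+u)·x·(x·x̂ⱼ₊₁) and (1+a)(1+u)x ≤ 2
        have h3 := mul_le_mul_of_nonneg_left hstep hx0.le
        have h4 : (1 + a) * ((1 + u) * x) ≤ (x * naivePower fl x (j + 1)) * ((1 + u) * x) := by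
          nlinarith
        exact le_of_mul_le_mul_right h4 (by positivity)
      exact nosig j hji.le 0 (by simpa using hsig) (by simpa using hQj)
  · push Not at hA
    by_cases hB : x * x < 2
    · -- §3.2, 1 + n²u < x² < 2: the very first argument has significand ≥ 1+a
      exact nosig 0 (by omega) 0 (by simpa using hA.le) (by simpa using hB)
    · push Not at hB
      have hxx4 : x * x < 4 := by nlinarith
      by_cases hC : 2 * (1 + a) ≤ x * x
      · -- x²/2 ≥ 1 + a: the significand of x² (binade [2,4)) is ≥ 1+a
        exact nosig 0 (by omega) 1 (by simp only [zero_add, naivePower_one, pow_one]; linarith)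
          (by simp only [zero_add, naivePower_one]; norm_num; exact hxx4)
      · push Not at hC
        -- 2 ≤ x² < 2(1+a): x ≥ 1+a and x³ < 4
        have hax : 1 + a ≤ x := by
          have h' : 0 ≤ (1 + a) ^ 2 * a := by positivity
          have : (1 + a) ^ 2 ≤ x ^ 2 := by nlinarith
          exact (pow_le_pow_iff_left₀ (by positivity) hx0.le two_ne_zero).mp this
        have hx3 : x ^ 3 < 4 := by
          have h6 : (x * x) ^ 3 < (2 * (1 + a)) ^ 3 :=
            pow_lt_pow_left₀ hC (by positivity) (by norm_num)
          by_contra h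
          push Not at h
          have : (4 : ℚ) ^ 2 ≤ (x ^ 3) ^ 2 := pow_le_pow_left₀ (by norm_num) h 2
          nlinarith
        -- `x·x̂ₙ₋₁ < 2^{n-1}` (else, for n = 3, the last rounding is downward onto 4 = 2²)
        have hT : x * naivePower fl x (i + 1) < (2 : ℚ) ^ (i + 1) := by
          obtain ⟨i', rfl⟩ : ∃ i', i = i' + 1 := ⟨i - 1, by omega⟩
          rcases Nat.eq_zero_or_pos i' with rfl | hi'
          · -- n = 3: x·x̂₂ ≤ (1+u) x³ < 4(1+u); if it is ≥ 4 then x̂₃ = RN(x·x̂₂) = 4 ≤ x·x̂₂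
            have hstep := (naivePower_step_bounds hp1 hfl hx0 0).2
            simp only [naivePower_one, zero_add] at hstep
            have hs_lt : x * naivePower fl x 2 < 4 * (1 + u) := by
              have h' := mul_le_mul_of_nonneg_left hstep hx0.le
              have h'' : (1 + u) * x ^ 3 < (1 + u) * 4 := mul_lt_mul_of_pos_left hx3 (by linarith)
              nlinarith
            by_contra h4
            push Not at h4
            norm_num at h4
            have hfl4 := fl_eq_zpow_of_lt hp1 hfl (e := 2) (t := x * naivePower fl x 2)
              (by norm_num; exact h4) (by norm_num; linarith)
            have h := nodown 1 (by omega)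
            have e3 : naivePower fl x (1 + 2) = fl (x * naivePower fl x 2) := rfl
            rw [e3, hfl4] at h
            norm_num at h
            linarith
          · -- n ≥ 4: (1+u)^{n-2} xⁿ < 2^{n-1} by comparing cubes
            obtain ⟨i'', rfl⟩ : ∃ i'', i' = i'' + 1 := ⟨i' - 1, by omega⟩
            have hle := naivePower_le hp1 hfl hx0 (i'' + 1 + 1)
            have hA3 : ((1 + u) ^ (i'' + 1 + 1) * x ^ (i'' + 1 + 1 + 2)) ^ 3
                < ((2 : ℚ) ^ (i'' + 1 + 1 + 1)) ^ 3 := by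
              have hP := one_add_pow_three_mul_le hu.le hu32 i''
              have hQ : (x ^ 3) ^ (i'' + 4) < (4 : ℚ) ^ (i'' + 4) :=
                pow_lt_pow_left₀ hx3 (by positivity) (by omega)
              have hPQ : (1 + u) ^ (3 * (i'' + 2)) * (x ^ 3) ^ (i'' + 4)
                  < (2 : ℚ) ^ (i'' + 1) * (4 : ℚ) ^ (i'' + 4) :=
                mul_lt_mul' hP hQ (by positivity) (by positivity)
              have e1 : ((1 + u) ^ (i'' + 1 + 1) * x ^ (i'' + 1 + 1 + 2)) ^ 3
                  = (1 + u) ^ (3 * (i'' + 2)) * (x ^ 3) ^ (i'' + 4) := by ring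
              have e2 : (2 : ℚ) ^ (i'' + 1) * (4 : ℚ) ^ (i'' + 4)
                  = ((2 : ℚ) ^ (i'' + 1 + 1 + 1)) ^ 3 := by
                rw [show (4 : ℚ) = 2 ^ 2 by norm_num, ← pow_mul, ← pow_add, ← pow_mul]
                congr 1; ring
              rw [e1, ← e2]; exact hPQ
            have hA : (1 + u) ^ (i'' + 1 + 1) * x ^ (i'' + 1 + 1 + 2)
                < (2 : ℚ) ^ (i'' + 1 + 1 + 1) :=
              lt_of_pow_lt_pow_left₀ 3 (by positivity) hA3
            calc x * naivePower fl x (i'' + 1 + 1 + 1)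
                ≤ x * ((1 + u) ^ (i'' + 1 + 1) * x ^ (i'' + 1 + 1 + 1)) := by gcongr
              _ = (1 + u) ^ (i'' + 1 + 1) * x ^ (i'' + 1 + 1 + 2) := by ring
              _ < _ := hA
        -- the first index where `x·x̂ₖ` drops below `2^k`: there `x̂` sits just above a power of 2
        have hQ0 : ¬ (x * naivePower fl x (0 + 1) < (2 : ℚ) ^ (0 + 1)) := by
          simp only [zero_add, naivePower_one, pow_one, not_lt]; exact hB
        obtain ⟨j, hji, hQj, hQj1⟩ :=
          exists_cross (Q := fun j => x * naivePower fl x (j + 1) < (2 : ℚ) ^ (j + 1)) hQ0 hT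
        simp only [not_lt] at hQj
        have hge : (2 : ℚ) ^ (j + 1) ≤ naivePower fl x (j + 2) := by
          rw [naivePower_succ_succ]
          exact le_fl_of_isFloatU_le hfl (isFloatU_two_pow hp1 (j + 1)) hQj
        have hsig : (1 + a) * (2 : ℚ) ^ (j + 1) ≤ x * naivePower fl x (j + 1 + 1) :=
          mul_le_mul hax hge (by positivity) hx0.le
        exact nosig (j + 1) (by omega) (j + 1) hsig hQj1

/-- **THEOREM 2** for `1 ≤ x < 2` and ANY round-to-nearest map (no tie rule assumed): if `p ≥ 5`
and `(1 + n²u)³ ≤ 2` — i.e. `n ≤ √(2^{1/3}-1)·2^{p/2}` — then `|x̂ₙ - xⁿ| ≤ (n-1)·u·xⁿ`.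
[cite: GraillatLefevreMuller2015, Thm 2] -/
theorem theorem2_unit (hp : 5 ≤ p) (hfl : IsRoundNearestU p fl) (hx : IsFloatU p x)
    (h1 : 1 ≤ x) (h2 : x < 2) {n : ℕ} (hn : 1 ≤ n)
    (hβ : (1 + (n : ℚ) ^ 2 * unitRoundoff p) ^ 3 ≤ 2) :
    |naivePower fl x n - x ^ n| ≤ ((n : ℚ) - 1) * unitRoundoff p * x ^ n := by
  have hp1 : 1 ≤ p := le_trans (by norm_num) hp
  have hu := u_pos (p := p)
  have hx0 : 0 < x := by linarith
  obtain ⟨k, rfl⟩ : ∃ k, n = k + 1 := ⟨n - 1, by omega⟩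
  have hxk : 0 < x ^ (k + 1) := pow_pos hx0 _
  rw [abs_le]
  constructor
  · -- lower half: Theorem 1 and Remark 1
    have hlo := le_naivePower hp1 hfl hx0 k
    have hB := remark1 (u := unitRoundoff p) (by linarith [u_le_half hp1]) k
    push_cast
    have : (1 - (k : ℚ) * unitRoundoff p) * x ^ (k + 1) ≤ naivePower fl x (k + 1) :=
      le_trans (mul_le_mul_of_nonneg_right hB hxk.le) hlo
    have e' : -(((k : ℚ) + 1 - 1) * unitRoundoff p * x ^ (k + 1))
        = (1 - (k : ℚ) * unitRoundoff p) * x ^ (k + 1) - x ^ (k + 1) := by ring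
    rw [e']
    linarith
  · rcases k with _ | i
    · simp
    · have e : ((i + 1 + 1 : ℕ) : ℚ) = (i : ℚ) + 2 := by push_cast; ring
      rw [e] at hβ
      have h := naivePower_le_upper hp hfl hx h1 h2 i hβ
      rw [show i + 1 + 1 = i + 2 from rfl]
      push_cast
      have e' : ((i : ℚ) + 2 - 1) * unitRoundoff p * x ^ (i + 2)
          = (1 + ((i : ℚ) + 1) * unitRoundoff p) * x ^ (i + 2) - x ^ (i + 2) := by ring
      rw [e']
      linarith

/-! ### Theorem 2 for every `x ∈ F`

The paper reduces to `1 ≤ x < 2` ("it suffices to prove it in the case `1 ≤ x < 2`"), which uses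
that `RN` = ties-to-even or ties-to-away commutes with `t ↦ -t` and `t ↦ 2t`.  An arbitrary
round-to-nearest map need not (its tie choices may vary from binade to binade), so the general
statement carries these two equivariances as hypotheses; both hold for the two tie rules of the
paper. -/

/-- Sign equivariance transports through one step. [cite: GraillatLefevreMuller2015, §3 (reduction to [1,2))] -/
theorem fl_sign_mul (hneg : ∀ t, fl (-t) = -fl t) {s : ℚ} (hs : s = 1 ∨ s = -1) (t : ℚ) :
    fl (s * t) = s * fl t := by
  rcases hs with rfl | rfl
  · simp
  · simp [hneg]

/-- Scale equivariance by `2` gives equivariance by every `2^j`, `j ∈ ℤ`.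
[cite: GraillatLefevreMuller2015, §3 (reduction to [1,2))] -/
theorem fl_two_zpow_mul (hscale : ∀ t, fl (2 * t) = 2 * fl t) (j : ℤ) (t : ℚ) :
    fl ((2 : ℚ) ^ j * t) = (2 : ℚ) ^ j * fl t := by
  have hnat : ∀ (n : ℕ) (s : ℚ), fl ((2 : ℚ) ^ n * s) = (2 : ℚ) ^ n * fl s := by
    intro n
    induction n with
    | zero => intro s; simp
    | succ n ih => intro s; rw [pow_succ, mul_comm _ (2 : ℚ), mul_assoc, hscale, ih]; ring
  obtain ⟨n, rfl | rfl⟩ := Int.eq_nat_or_neg j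
  · rw [zpow_natCast]; exact hnat n t
  · have h := hnat n ((2 : ℚ) ^ (-(n : ℤ)) * t)
    have h2 : (0 : ℚ) < (2 : ℚ) ^ n := by positivity
    have h2n : (2 : ℚ) ^ n * (2 : ℚ) ^ (-(n : ℤ)) = 1 := by
      rw [zpow_neg, zpow_natCast, mul_inv_cancel₀ h2.ne']
    rw [← mul_assoc, h2n, one_mul] at h
    have key : fl ((2 : ℚ) ^ (-(n : ℤ)) * t) = ((2 : ℚ) ^ n)⁻¹ * fl t := by
      rw [h, ← mul_assoc, inv_mul_cancel₀ h2.ne', one_mul]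
    rw [key, zpow_neg, zpow_natCast]

/-- Equivariance under the units `±2^e` and their powers. [cite: GraillatLefevreMuller2015, §3 (reduction to [1,2))] -/
theorem fl_unit_pow_mul (hneg : ∀ t, fl (-t) = -fl t) (hscale : ∀ t, fl (2 * t) = 2 * fl t)
    {s : ℚ} (hs : s = 1 ∨ s = -1) (e : ℤ) :
    ∀ (m : ℕ) (t : ℚ), fl ((s * (2 : ℚ) ^ e) ^ m * t) = (s * (2 : ℚ) ^ e) ^ m * fl t
  | 0, t => by simp
  | m + 1, t => by
    rw [pow_succ, mul_assoc, fl_unit_pow_mul hneg hscale hs e m, mul_assoc s, fl_sign_mul hneg hs,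
      fl_two_zpow_mul hscale]
    ring

/-- Algorithm 1 is covariant under `x ↦ ±2^e·x` when `RN` is: `x̂ₖ(c·ξ) = c^k · x̂ₖ(ξ)` for
`c = ±2^e`. [cite: GraillatLefevreMuller2015, §3 (reduction to [1,2))] -/
theorem naivePower_unit_mul (hneg : ∀ t, fl (-t) = -fl t) (hscale : ∀ t, fl (2 * t) = 2 * fl t)
    {s : ℚ} (hs : s = 1 ∨ s = -1) (e : ℤ) (ξ : ℚ) :
    ∀ k : ℕ, naivePower fl (s * (2 : ℚ) ^ e * ξ) (k + 1)
      = (s * (2 : ℚ) ^ e) ^ (k + 1) * naivePower fl ξ (k + 1)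
  | 0 => by simp
  | k + 1 => by
    rw [naivePower_succ_succ, naivePower_succ_succ, naivePower_unit_mul hneg hscale hs e ξ k,
      show s * (2 : ℚ) ^ e * ξ * ((s * (2 : ℚ) ^ e) ^ (k + 1) * naivePower fl ξ (k + 1))
        = (s * (2 : ℚ) ^ e) ^ (k + 2) * (ξ * naivePower fl ξ (k + 1)) by ring,
      fl_unit_pow_mul hneg hscale hs e]

/-- `F` is stable under scaling by powers of two (unbounded exponent range). [cite: GraillatLefevreMuller2015, §1.1] -/
theorem isFloatU_mul_two_zpow {y : ℚ} (hy : IsFloatU p y) (j : ℤ) :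
    IsFloatU p (y * (2 : ℚ) ^ j) := by
  obtain ⟨M, e, hM, rfl⟩ := hy
  exact ⟨M, e + j, hM, by rw [zpow_add₀ (by norm_num)]; ring⟩

/-- Every non-zero float is `±2^e·ξ` with `ξ ∈ F ∩ [1,2)`. [cite: GraillatLefevreMuller2015, §3 (reduction to [1,2))] -/
theorem exists_unit_mul_of_ne_zero (hx : IsFloatU p x) (hx0 : x ≠ 0) :
    ∃ (s : ℚ) (e : ℤ) (ξ : ℚ), (s = 1 ∨ s = -1) ∧ IsFloatU p ξ ∧ 1 ≤ ξ ∧ ξ < 2 ∧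
      x = s * (2 : ℚ) ^ e * ξ := by
  have hy : 0 < |x| := abs_pos.mpr hx0
  set e := Int.log 2 |x| with he
  have h1 : (2 : ℚ) ^ e ≤ |x| := by
    have := Int.zpow_log_le_self (b := 2) one_lt_two hy
    push_cast at this; exact this
  have h2 : |x| < (2 : ℚ) ^ (e + 1) := by
    have := Int.lt_zpow_succ_log_self (b := 2) one_lt_two |x|
    push_cast at this; exact this
  have h2e : (0 : ℚ) < (2 : ℚ) ^ e := zpow_pos (by norm_num) e
  have habs : IsFloatU p |x| := by
    rcases le_or_gt 0 x with h | h
    · rw [abs_of_nonneg h]; exact hx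
    · rw [abs_of_neg h]; exact hx.neg
  refine ⟨if 0 ≤ x then 1 else -1, e, |x| * (2 : ℚ) ^ (-e), ?_,
    isFloatU_mul_two_zpow habs (-e), ?_, ?_, ?_⟩
  · by_cases h : 0 ≤ x <;> simp [h]
  · rw [zpow_neg, ← div_eq_mul_inv, le_div_iff₀ h2e]; linarith
  · rw [zpow_neg, ← div_eq_mul_inv, div_lt_iff₀ h2e, zpow_add_one₀ (by norm_num)] at *; linarith
  · have hee : (2 : ℚ) ^ e * (2 : ℚ) ^ (-e) = 1 := by
      rw [zpow_neg, mul_inv_cancel₀ h2e.ne']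
    by_cases h : 0 ≤ x
    · simp only [h, if_true, one_mul]
      rw [abs_of_nonneg h, mul_comm x, ← mul_assoc, mul_comm ((2:ℚ)^e), mul_assoc ((2:ℚ)^(-e)),
        ← mul_assoc, mul_comm ((2:ℚ)^(-e)), hee, one_mul]
    · simp only [h, if_false]
      push Not at h
      rw [abs_of_neg h]
      have : (2 : ℚ) ^ e * (-x * (2 : ℚ) ^ (-e)) = -x := by
        rw [mul_comm (-x), ← mul_assoc, hee, one_mul]
      rw [mul_assoc, this]; ring

/-- **THEOREM 2** (Graillat–Lefèvre–Muller): radix 2, precision `p ≥ 5`, unbounded exponent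
range, `RN` a round-to-nearest map commuting with `t ↦ -t` and `t ↦ 2t` (as ties-to-even and
ties-to-away do).  If `(1 + n²u)³ ≤ 2`, i.e. `n ≤ √(2^{1/3}-1)·2^{p/2}`, then for every `x ∈ F`
`|x̂ₙ - xⁿ| ≤ (n-1)·u·|xⁿ|` — the classical bound `γ_{n-1}` / `ψ_{n-1}` may be replaced by its
first-order term. [cite: GraillatLefevreMuller2015, Thm 2] -/
theorem theorem2 (hp : 5 ≤ p) (hfl : IsRoundNearestU p fl) (hneg : ∀ t, fl (-t) = -fl t)
    (hscale : ∀ t, fl (2 * t) = 2 * fl t) (hx : IsFloatU p x) {n : ℕ} (hn : 1 ≤ n)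
    (hβ : (1 + (n : ℚ) ^ 2 * unitRoundoff p) ^ 3 ≤ 2) :
    |naivePower fl x n - x ^ n| ≤ ((n : ℚ) - 1) * unitRoundoff p * |x ^ n| := by
  have hp1 : 1 ≤ p := le_trans (by norm_num) hp
  obtain ⟨k, rfl⟩ : ∃ k, n = k + 1 := ⟨n - 1, by omega⟩
  by_cases hx0 : x = 0
  · subst hx0
    have h0 : fl 0 = 0 := fl_eq_self hfl (isFloatU_int (p := p) (M := 0) (by simp))
    rcases k with _ | k
    · simp
    · simp [naivePower_succ_succ, h0]
  obtain ⟨s, e, ξ, hs, hξ, h1, h2, rfl⟩ := exists_unit_mul_of_ne_zero hx hx0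
  have hξ0 : 0 < ξ := by linarith
  have hmain := theorem2_unit hp hfl hξ h1 h2 (n := k + 1) (by omega) hβ
  have ex : (s * (2 : ℚ) ^ e * ξ) ^ (k + 1) = (s * (2 : ℚ) ^ e) ^ (k + 1) * ξ ^ (k + 1) := by ring
  rw [naivePower_unit_mul hneg hscale hs e ξ k, ex, ← mul_sub, abs_mul, abs_mul,
    abs_of_pos (pow_pos hξ0 _)]
  have h := mul_le_mul_of_nonneg_left hmain (abs_nonneg ((s * (2 : ℚ) ^ e) ^ (k + 1)))
  exact le_trans h (le_of_eq (by ring))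

/-- The upper limit `n_max = ⌊√(2^{1/3}-1)·2^{p/2}⌋` of Theorem 2 for the three basic IEEE-754
binary formats (the table following the proof): `2088` (binary32, `p = 24`), `48385542`
(binary64, `p = 53`), `51953580258461959` (binary128, `p = 113`) — each satisfies
`(1 + n²u)³ ≤ 2` and its successor does not. [cite: GraillatLefevreMuller2015, §3.3 (table)] -/
theorem nmax_table :
    ((1 + (2088 : ℚ) ^ 2 * unitRoundoff 24) ^ 3 ≤ 2 ∧
      ¬ (1 + (2089 : ℚ) ^ 2 * unitRoundoff 24) ^ 3 ≤ 2) ∧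
    ((1 + (48385542 : ℚ) ^ 2 * unitRoundoff 53) ^ 3 ≤ 2 ∧
      ¬ (1 + (48385543 : ℚ) ^ 2 * unitRoundoff 53) ^ 3 ≤ 2) ∧
    ((1 + (51953580258461959 : ℚ) ^ 2 * unitRoundoff 113) ^ 3 ≤ 2 ∧
      ¬ (1 + (51953580258461960 : ℚ) ^ 2 * unitRoundoff 113) ^ 3 ≤ 2) := by
  unfold unitRoundoff
  norm_num

end Literature.ComputerArithmetic.GraillatLefevreMuller2015
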